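import Literature.Probability.RandomPlanarGeometry.HexSAWArmchairSecondOrder
import HarnessLib

/-!
# Beaton's ROTATED (armchair) honeycomb surface: the THIRD-order term from ABOVE —
# `β_rot(y)⁴ ≤ y² + 2 + 2/y + 423188/(y√y)` (`y ≥ 10⁴`), i.e. `β_rot(y)² ≤ y + 1/y + 1/y² + O(y^{−5/2})`:
# `limsup_{y→∞} y²(β_rot(y)² − y − 1/y) ≤ 1` (three-step-alive arches; the eight-fibre is empty, the nine-fibre has exactly two shapes)

Topic `Literature/Probability/RandomPlanarGeometry` (lane «pcv-sawmu», car «ARM-THIRD-ORDER-UPPER», a-p6 g15).  Input: the two-step-alive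
fibre machinery of `HexSAWArmchairSecondOrder.lean` («ARM-SECOND-ORDER-UPPER»: `fibA`, `launch_context`, the empty four/five-fibres, the dead
six-fibre, the two seven shapes, `sum_pow_mul_three_pow_le`, `armRate_le_of_WB_le`).  Here the arches are required to be THREE-step alive
(every wall bridge is: `(1,Y_n)(1,Y_n+1)(0,Y_n+1)` is fresh above its top end), prefixes are cut at least three steps before the end, and two
more fibres are resolved exactly: with the launch context one step further back (`ω_{k−3} ∈ {(2,Y−τ), (1,Y−2τ)}`) the EIGHT-step excursion is
unique — `(1,Y)(2,Y)(3,Y)(3,Y+τ)(2,Y+τ)(2,Y+2τ)(1,Y+2τ)(0,Y+2τ)` — and DEAD within three steps, and the two-step-alive NINE-step excursions are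
exactly the two defects `Defect.nineA/nineB` of «ARM-SECOND-ORDER-LOWER» (a third, downward, nine-step excursion exists when `ω_{k−3} = (1,Y−2τ)`
but is not two-step alive).  The recursion `a_{j+12} ≤ y b_{j+9} + 2y b_{j+5} + 2y b_{j+3} + y Σ_{k ≤ j+2} X_k 3^{j+11−k}` then closes with
`ρ⁴ = y² + 2 + 2/y + 423188/(y√y)`.

Sources.  N. R. Beaton, CMP 326 (2014) 727–754 = arXiv:1210.0274v3, §3 (pp. 10–11), §3.1 (p. 12).  J. M. Hammersley, G. M. Torrie,
S. G. Whittington, J. Phys. A 15 (1982) 539–571, §2 (as summarised by Beaton 2014 arXiv v3 p. 11; locator provisional).  N. Madras, G. Slade,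
*The Self-Avoiding Walk* (1993), §1.2 (Lemma 1.2.2, (1.2.3), (1.2.10), (1.2.17)).  I. G. Enting, I. Jensen, in *Polygons, Polyominoes and
Polycubes*, LNP 775 (2009), §7.4.2, Fig. 7.10 (brick-wall form of the honeycomb lattice).

## What is proved (namespace `…SAW.HexBW.Arm`, then `…SAW.HV`)

* §1–§3 three-step-alive classes `Alive3` (`Alive3.alive2`), `archesA3/archesB3/arches3`, `a3W/b3W/aX3w`, `aX3w_eq`, `alive3_of_mem_wb`,
  `WB_le_aX3w`, `prefixWalk_mem_arches3` (`k+3 ≤ n`), `b3W_le`, `sum_fibre_lastV_le_X3a`, `sum_fibA_le_X3a` (`k+1 ≤ m`), `sum_fibA_self_le_b3W`,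
  `sum_fibA_seven_le3`.
* §4 `launch_context₃`; the eight-fibre: `fibA_eight_dead_1a/1b/2`, `fibA_eight_head`, `fibA_eight_coords`, ★★ `not_alive3_of_mem_fibA_eight (3 ≤ k)`.
* §5 the nine-fibre: `fibA_nine_dead_S1a/S2/W1/W2a`, `fibA_nine_S1b`, `fibA_nine_W1_chain`, `fibA_nine_W2b`, `fibA_nine_coords`, `fibA_nine_coords₂`,
  ★★ `sum_fibA_nine_le3 (3 ≤ k) : Σ_{fibA (k+6) k ∩ Alive2} y^{visits} ≤ 2y · b3W k`.
* §6 `a3W_le_rec`, `a3W_b3W_le_mul_pow` (growth: `y²ρ⁸ + 2y²ρ⁴ + 2y²ρ² + 39366yρ² + 216513y²ρ ≤ ρ¹²` ⇒ `a_n ≤ 3¹²y¹³ρⁿ`), `armRate_le_of_growth`.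
* §7 `rho_facts₃`; ★★★ **`armRate_pow_four_le_third (10⁴ ≤ y) : β_rot⁴ ≤ y² + 2 + 2/y + 423188/(y√y)`**; ★★★ `armRate_sq_le_third :
  β_rot² ≤ y + 1/y + 1/y² + 211595/(y²√y)`; ★★★ `sq_mul_armRate_sq_sub_sub_le : y²(β_rot² − y − 1/y) ≤ 1 + 211595/√y`;
  `eventually_sq_mul_armRate_sq_sub_sub_le` (limsup ≤ 1).  §8 `HV.rotSurfaceMu_sq_le_third`, `HV.eventually_sq_mul_rotSurfaceMu_sq_sub_sub_le`.

HONEST LABEL (author's proposal).  LANE THEOREM (S) / NEW-IN-WRITING (modest, S): «μ_rot(y)² ≤ y + 1/y + 1/y² + O(y^{−5/2})»; with the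
companion «ARM-THIRD-ORDER-LOWER» (`liminf y²(μ_rot² − y − 1/y) ≥ 1`) the third coefficient of Beaton's armchair adsorbed-phase expansion
EQUALS the zig-zag one: `μ_rot(y)² = y + 1/y + 1/y² + o(y⁻²)`.  NOT CLAIMED: anything for `y < 10⁴` (constants not optimised), the fourth order.
-/

noncomputable section

open Finset Filter Function
open Literature.Probability.LatticeModels Literature.Probability.Percolation SimpleGraph
open _root_.Topology

namespace Literature.Probability.RandomPlanarGeometry.SAW.HexBW.Arm

variable {y : ℝ} {n : ℕ} {ω : ℕ → Site 2}

/-! ### §1  Three-step-alive arches, by arrival class -/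

/-- An `n`-step walk of the half-plane `X ≥ 0` is **three-step alive** if it admits a self-avoiding continuation by two fresh sites
`z₁ z₂` of the half-plane (consecutive brick-wall neighbours, not visited during `[0, n]`).  The «skip-and-return» ending
`(0,Y) (1,Y) (1,Y+1) (2,Y+1) (2,Y+2) (1,Y+2) (0,Y+2)` (which lands on the TOP of the next dimer) is one-step but NOT two-step alive: the only
fresh neighbour is the skipped bottom `(0,Y+1)`, whose other neighbour `(1,Y+1)` is used. [cite: HammersleyTorrieWhittington1982, §2 (unfolded surface walks; locator provisional, source not held); EntingJensen2009, §7.4.2, Fig. 7.10] -/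
def Alive3 (n : ℕ) (ω : ℕ → Site 2) : Prop :=
  ∃ z₁ z₂ z₃ : Site 2, brickWallGraph.Adj (ω n) z₁ ∧ brickWallGraph.Adj z₁ z₂ ∧ brickWallGraph.Adj z₂ z₃ ∧ z₁ ≠ z₃ ∧
    0 ≤ z₁ 0 ∧ 0 ≤ z₂ 0 ∧ 0 ≤ z₃ 0 ∧ ∀ i ≤ n, ω i ≠ z₁ ∧ ω i ≠ z₂ ∧ ω i ≠ z₃

/-- Three-step alive implies two-step alive. [cite: HammersleyTorrieWhittington1982, §2 (unfolded surface walks; locator provisional)] -/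
theorem Alive3.alive2 {n : ℕ} {ω : ℕ → Site 2} (h : Alive3 n ω) : Alive2 n ω := by
  obtain ⟨z₁, z₂, z₃, h1, h2, -, -, hz1, hz2, -, hf⟩ := h
  exact ⟨z₁, z₂, h1, h2, hz1, hz2, fun i hi => ⟨(hf i hi).1, (hf i hi).2.1⟩⟩

open Classical in
/-- Alive arches arriving from OFF the wall (class `A`: `ω (n−1)` off the wall). [cite: HammersleyTorrieWhittington1982, §2 (unfolded surface walks; locator provisional)] -/
def archesA3 (n : ℕ) : Finset (ℕ → Site 2) := (arches n).filter fun ω => ω (n - 1) 0 ≠ 0 ∧ Alive3 n ω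

open Classical in
/-- Alive arches arriving ALONG the wall (class `B`: `ω (n−1)` on the wall; includes the empty arch `n = 0`). [cite: HammersleyTorrieWhittington1982, §2] -/
def archesB3 (n : ℕ) : Finset (ℕ → Site 2) := (arches n).filter fun ω => ω (n - 1) 0 = 0 ∧ Alive3 n ω

open Classical in
/-- All alive arches. [cite: HammersleyTorrieWhittington1982, §2] -/
def arches3 (n : ℕ) : Finset (ℕ → Site 2) := (arches n).filter (Alive3 n)

open Classical in
/-- `a_n(y)`: weighted alive class-`A` arches. [cite: HammersleyTorrieWhittington1982, §2] -/
def a3W (n : ℕ) (y : ℝ) : ℝ := ∑ ω ∈ archesA3 n, y ^ visits n ω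

open Classical in
/-- `b_n(y)`: weighted alive class-`B` arches. [cite: HammersleyTorrieWhittington1982, §2] -/
def b3W (n : ℕ) (y : ℝ) : ℝ := ∑ ω ∈ archesB3 n, y ^ visits n ω

open Classical in
/-- `X_n(y)`: weighted alive arches. [cite: HammersleyTorrieWhittington1982, §2] -/
def aX3w (n : ℕ) (y : ℝ) : ℝ := ∑ ω ∈ arches3 n, y ^ visits n ω

open Classical in
/-- `X_n = a_n + b_n`. [cite: HammersleyTorrieWhittington1982, §2] -/
theorem aX3w_eq (n : ℕ) (y : ℝ) : aX3w n y = a3W n y + b3W n y := by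
  rw [aX3w, a3W, b3W, archesA3, archesB3, arches3]
  have h : (arches n).filter (Alive3 n) =
      ((arches n).filter fun ω => ω (n - 1) 0 ≠ 0 ∧ Alive3 n ω) ∪ ((arches n).filter fun ω => ω (n - 1) 0 = 0 ∧ Alive3 n ω) := by
    ext ω; simp only [Finset.mem_filter, Finset.mem_union]; tauto
  rw [h, Finset.sum_union]
  exact Finset.disjoint_filter.2 fun ω _ h1 h2 => h1.1 h2.1

open Classical in
/-- `a_n ≥ 0`. [cite: HammersleyTorrieWhittington1982, §2] -/
theorem a3W_nonneg (n : ℕ) (hy : 0 ≤ y) : 0 ≤ a3W n y := Finset.sum_nonneg fun _ _ => pow_nonneg hy _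
open Classical in
/-- `b_n ≥ 0`. [cite: HammersleyTorrieWhittington1982, §2] -/
theorem b3W_nonneg (n : ℕ) (hy : 0 ≤ y) : 0 ≤ b3W n y := Finset.sum_nonneg fun _ _ => pow_nonneg hy _
open Classical in
/-- `X_n ≥ 0`. [cite: HammersleyTorrieWhittington1982, §2] -/
theorem aX3w_nonneg (n : ℕ) (hy : 0 ≤ y) : 0 ≤ aX3w n y := Finset.sum_nonneg fun _ _ => pow_nonneg hy _
open Classical in
/-- `X_n ≤ A_n`. [cite: HammersleyTorrieWhittington1982, §2] -/
theorem aX3w_le_Aw (n : ℕ) (hy : 0 ≤ y) : aX3w n y ≤ Aw n y :=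
  Finset.sum_le_sum_of_subset_of_nonneg (Finset.filter_subset _ _) fun _ _ _ => pow_nonneg hy _
open Classical in
/-- `a_n ≤ X_n`. [cite: HammersleyTorrieWhittington1982, §2] -/
theorem a3W_le_aX3w (n : ℕ) (hy : 0 ≤ y) : a3W n y ≤ aX3w n y := by
  rw [aX3w_eq]; exact le_add_of_nonneg_right (b3W_nonneg n hy)
open Classical in
/-- `b_n ≤ X_n`. [cite: HammersleyTorrieWhittington1982, §2] -/
theorem b3W_le_aX3w (n : ℕ) (hy : 0 ≤ y) : b3W n y ≤ aX3w n y := by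
  rw [aX3w_eq]; exact le_add_of_nonneg_left (a3W_nonneg n hy)

/-- **Every armchair wall bridge is three-step alive**: its end `(0, Y_n)` is the TOP of a dimer (`Y_n` odd) above every earlier vertex, so
`(1, Y_n) (1, Y_n + 1) (0, Y_n + 1)` is a fresh continuation. [cite: Beaton2014RotatedHoneycomb, §3.1 (arXiv v3 p. 12: unfolded walks); EntingJensen2009, §7.4.2, Fig. 7.10] -/
theorem alive3_of_mem_wb (hn : 1 ≤ n) (hω : ω ∈ wb n) : Alive3 n ω := by
  obtain ⟨hωa, hwb⟩ := mem_wb.1 hω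
  obtain ⟨hωh, hend⟩ := mem_arches.1 hωa
  have hodd : ω n 1 % 2 = 1 := wb_end_odd hω
  obtain ⟨hYn, hin⟩ := hwb
  obtain ⟨hωs, -⟩ := mem_hp.1 hωh
  obtain ⟨h0, -, -, -⟩ := mem_saws_iff.1 hωs
  refine ⟨pt 1 (ω n 1), pt 1 (ω n 1 + 1), pt 0 (ω n 1 + 1), ?_, ?_, ?_, ?_, by simp, by simp, by simp,
    fun i hi => ⟨fun h => ?_, fun h => ?_, fun h => ?_⟩⟩
  · rw [brickWallGraph_adj_coord, pt_apply_zero, pt_apply_one]; omega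
  · rw [brickWallGraph_adj_coord, pt_apply_zero, pt_apply_one, pt_apply_zero, pt_apply_one]
    omega
  · rw [brickWallGraph_adj_coord, pt_apply_zero, pt_apply_one, pt_apply_zero, pt_apply_one]
    omega
  · intro h; have := congrFun h 0; rw [pt_apply_zero, pt_apply_zero] at this; norm_num at this
  · have h1 := congrFun h 1
    have hx := congrFun h 0
    rw [pt_apply_one] at h1
    rw [pt_apply_zero] at hx
    rcases Nat.lt_or_ge i n with hi' | hi'
    · rcases Nat.eq_zero_or_pos i with rfl | hi0
      · rw [h0] at hx; simp at hx
      · have := (hin i hi0 hi').2; omega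
    · have : i = n := le_antisymm hi hi'
      subst this; omega
  · have h1 := congrFun h 1
    rw [pt_apply_one] at h1
    rcases Nat.lt_or_ge i n with hi' | hi'
    · rcases Nat.eq_zero_or_pos i with rfl | hi0
      · rw [h0] at h1; simp at h1; omega
      · have := (hin i hi0 hi').2; omega
    · have : i = n := le_antisymm hi hi'
      subst this; omega
  · have h1 := congrFun h 1
    rw [pt_apply_one] at h1
    rcases Nat.lt_or_ge i n with hi' | hi'
    · rcases Nat.eq_zero_or_pos i with rfl | hi0
      · rw [h0] at h1; simp at h1; omega
      · have := (hin i hi0 hi').2; omega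
    · have : i = n := le_antisymm hi hi'
      subst this; omega

open Classical in
/-- `wb n ⊆ arches3 n` (`n ≥ 1`). [cite: Beaton2014RotatedHoneycomb, §3.1 (arXiv v3 p. 12)] -/
theorem wb_subset_arches3 (hn : 1 ≤ n) : wb n ⊆ arches3 n :=
  fun _ hω => Finset.mem_filter.2 ⟨wb_subset hω, alive3_of_mem_wb hn hω⟩

open Classical in
/-- **`B^w_n(y) ≤ X_n(y)`** (`n ≥ 1`, `y ≥ 0`). [cite: Beaton2014RotatedHoneycomb, §3.1 (arXiv v3 p. 12)] -/
theorem WB_le_aX3w (hn : 1 ≤ n) (hy : 0 ≤ y) : WB n y ≤ aX3w n y :=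
  Finset.sum_le_sum_of_subset_of_nonneg (wb_subset_arches3 hn) fun _ _ _ => pow_nonneg hy _

/-! ### §2  Prefixes cut at a wall visit two steps before the end are alive -/

/-- The prefix of a half-plane walk up to a wall visit at time `k` with `k + 2 ≤ n` is an ALIVE arch (witnesses `ω (k+1)`, `ω (k+2)`),
with the same visits. [cite: MadrasSlade1993, §1.2, (1.2.3); EntingJensen2009, §7.4.2, Fig. 7.10] -/
theorem prefixWalk_mem_arches3 (hω : ω ∈ hp n) {k : ℕ} (hk : k + 3 ≤ n) (hX : ω k 0 = 0) :
    Zd.prefixWalk k ω ∈ arches3 k ∧ visits k (Zd.prefixWalk k ω) = visits k ω := by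
  classical
  obtain ⟨hpa, hpv⟩ := prefixWalk_mem_arches hω (by omega) hX
  refine ⟨Finset.mem_filter.2 ⟨hpa, ?_⟩, hpv⟩
  obtain ⟨hωs, hH⟩ := mem_hp.1 hω
  obtain ⟨-, -, hbw, hinj⟩ := mem_saws_iff.1 hωs
  have hv : ∀ i ≤ k, Zd.prefixWalk k ω i = ω i := fun i hi => by simp [Zd.prefixWalk, min_eq_left hi]
  have hne : ∀ a b : ℕ, a ≤ n → b ≤ n → a ≠ b → ω a ≠ ω b := fun a b ha hb hab h =>
    hab (hinj (show a ∈ {j | j ≤ n} by simp only [Set.mem_setOf_eq]; exact ha)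
      (show b ∈ {j | j ≤ n} by simp only [Set.mem_setOf_eq]; exact hb) h)
  refine ⟨ω (k + 1), ω (k + 2), ω (k + 3), ?_, ?_, ?_, hne _ _ (by omega) (by omega) (by omega),
    hH _ (by omega), hH _ (by omega), hH _ (by omega), fun i hi => ⟨?_, ?_, ?_⟩⟩
  · rw [hv k le_rfl]; exact hbw k (by omega)
  · have := hbw (k + 1) (by omega); rwa [show k + 1 + 1 = k + 2 by omega] at this
  · have := hbw (k + 2) (by omega); rwa [show k + 2 + 1 = k + 3 by omega] at this
  all_goals rw [hv i hi]; exact hne _ _ (by omega) (by omega) (by omega)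

/-! ### §3  The dimer step and the long fibres, with alive prefixes -/

open Classical in
/-- **`b_{m+2}(y) ≤ y · a_{m+1}(y)`** (`y ≥ 0`): drop the final dimer step of an alive class-`B` arch — the prefix is class `A`
(`no_three_walls`) and ALIVE (witnesses: the dropped end and the first site of the arch's own continuation).
[cite: HammersleyTorrieWhittington1982, §2 (as summarised by Beaton 2014 arXiv v3 p. 11; locator provisional); EntingJensen2009, §7.4.2, Fig. 7.10] -/
theorem b3W_le (m : ℕ) (hy : 0 ≤ y) : b3W (m + 2) y ≤ y * a3W (m + 1) y := by
  set FB := archesB3 (m + 2) with hFB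
  set g : (ℕ → Site 2) → (ℕ → Site 2) := fun ω => Zd.prefixWalk (m + 1) ω with hg
  have hprops : ∀ ω ∈ FB, g ω ∈ archesA3 (m + 1) ∧ visits (m + 2) ω = visits (m + 1) (g ω) + 1 := by
    intro ω hω
    obtain ⟨hωa, hB, hal⟩ := Finset.mem_filter.1 hω
    rw [show m + 2 - 1 = m + 1 by omega] at hB
    obtain ⟨hωh, hend⟩ := mem_arches.1 hωa
    have hωs := hp_subset hωh
    obtain ⟨-, -, hbw, hinj⟩ := mem_saws_iff.1 hωs
    obtain ⟨hpa, hpv⟩ := prefixWalk_mem_arches hωh (show m + 1 ≤ m + 2 by omega) hB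
    have hv : ∀ i ≤ m + 1, g ω i = ω i := fun i hi => by simp [hg, Zd.prefixWalk, min_eq_left hi]
    have hclassA : g ω (m + 1 - 1) 0 ≠ 0 := by
      rw [show m + 1 - 1 = m by omega, hv m (by omega)]
      intro h2
      exact no_three_walls hωh (i := m) (by omega) ⟨h2, hB, hend⟩
    have hne : ∀ a b : ℕ, a ≤ m + 2 → b ≤ m + 2 → a ≠ b → ω a ≠ ω b := fun a b ha hb hab h =>
      hab (hinj (show a ∈ {j | j ≤ m + 2} by simp only [Set.mem_setOf_eq]; exact ha)
        (show b ∈ {j | j ≤ m + 2} by simp only [Set.mem_setOf_eq]; exact hb) h)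
    have hH2 : 0 ≤ ω (m + 2) 0 := (mem_hp.1 hωh).2 (m + 2) le_rfl
    have hstep : brickWallGraph.Adj (ω (m + 1)) (ω (m + 2)) := by
      have := hbw (m + 1) (by omega); rwa [show m + 1 + 1 = m + 2 by omega] at this
    have halive : Alive3 (m + 1) (g ω) := by
      obtain ⟨z₁, z₂, z₃, hz1, hz2, -, h13, hz1', hz2', -, hfresh⟩ := hal
      refine ⟨ω (m + 2), z₁, z₂, ?_, hz1, hz2, ?_, hH2, hz1', hz2', fun i hi => ⟨?_, ?_, ?_⟩⟩
      · rw [hv (m + 1) le_rfl]; exact hstep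
      · exact (hfresh (m + 2) le_rfl).2.1
      · rw [hv i hi]; exact hne _ _ (by omega) (by omega) (by omega)
      · rw [hv i hi]; exact (hfresh i (by omega)).1
      · rw [hv i hi]; exact (hfresh i (by omega)).2.1
    refine ⟨Finset.mem_filter.2 ⟨hpa, hclassA, halive⟩, ?_⟩
    rw [show m + 2 = m + 1 + 1 by omega, visits_succ, if_pos hend, hpv]
  have hinj : Set.InjOn g ↑FB := by
    intro ω hω ω' hω' h
    rw [Finset.mem_coe] at hω hω'
    obtain ⟨hωa, hB, -⟩ := Finset.mem_filter.1 hω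
    obtain ⟨hωa', hB', -⟩ := Finset.mem_filter.1 hω'
    rw [show m + 2 - 1 = m + 1 by omega] at hB hB'
    obtain ⟨hωh, hend⟩ := mem_arches.1 hωa
    obtain ⟨hωh', hend'⟩ := mem_arches.1 hωa'
    have hωs := hp_subset hωh
    have hωs' := hp_subset hωh'
    have hagree : ∀ i ≤ m + 1, ω i = ω' i := fun i hi => by
      have := congrFun h i
      simpa [hg, Zd.prefixWalk, min_eq_left hi] using this
    refine eq_of_agree hωs hωs' fun i hi => ?_
    rcases Nat.lt_or_ge i (m + 2) with hi' | hi'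
    · exact hagree i (by omega)
    · have hin : i = m + 2 := le_antisymm hi hi'
      subst hin
      obtain ⟨-, -, hbw, -⟩ := mem_saws_iff.1 hωs
      obtain ⟨-, -, hbw', -⟩ := mem_saws_iff.1 hωs'
      have hst := hbw (m + 1) (by omega)
      have hst' := hbw' (m + 1) (by omega)
      have e1 := wall_step_eq hst hB hend
      have e1' := wall_step_eq hst' hB' hend'
      rw [site_two_eq_iff]
      refine ⟨by rw [hend, hend'], ?_⟩
      rw [e1, e1', hagree (m + 1) le_rfl]
  calc b3W (m + 2) y = ∑ ω ∈ FB, y ^ visits (m + 2) ω := rfl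
    _ = ∑ ω ∈ FB, y * y ^ visits (m + 1) (g ω) := Finset.sum_congr rfl fun ω hω => by
        rw [(hprops ω hω).2, pow_succ, mul_comm]
    _ = y * ∑ ξ ∈ FB.image g, y ^ visits (m + 1) ξ := by rw [Finset.mul_sum, Finset.sum_image hinj]
    _ ≤ y * a3W (m + 1) y := by
        refine mul_le_mul_of_nonneg_left ?_ hy
        rw [a3W]
        refine Finset.sum_le_sum_of_subset_of_nonneg (fun ξ hξ => ?_) fun _ _ _ => pow_nonneg hy _
        obtain ⟨ω, hω, rfl⟩ := Finset.mem_image.1 hξ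
        exact (hprops ω hω).1

open Classical in
/-- The walks of `hp n` with last wall visit at time `k ≤ n − 2` weigh at most `X_k(y) · c_{n−k}(ℍ)` (alive prefix / twisted suffix).
[cite: HammersleyTorrieWhittington1982, §2; MadrasSlade1993, §1.2, (1.2.3)] -/
theorem sum_fibre_lastV_le_X3a (hy : 0 ≤ y) {k : ℕ} (hk : k + 3 ≤ n) :
    ∑ ω ∈ (hp n).filter (fun ω => lastV n ω = k), y ^ visits n ω ≤ aX3w k y * #(saws (n - k)) := by
  set F := (hp n).filter (fun ω => lastV n ω = k)
  set g : (ℕ → Site 2) → (ℕ → Site 2) × (ℕ → Site 2) :=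
    fun ω => (Zd.prefixWalk k ω, fun i => twistAt (ω k) (Zd.suffixWalk k (n - k) ω i)) with hg
  have hF : ∀ ω ∈ F, ω ∈ hp n ∧ lastV n ω = k := fun ω hω => Finset.mem_filter.1 hω
  have hprops : ∀ ω ∈ F, visits n ω = visits k (Zd.prefixWalk k ω) ∧
      Zd.prefixWalk k ω ∈ arches3 k ∧ (fun i => twistAt (ω k) (Zd.suffixWalk k (n - k) ω i)) ∈ saws (n - k) := by
    intro ω hω
    obtain ⟨hωh, hl⟩ := hF ω hω
    have hωs := hp_subset hωh
    obtain ⟨h0, -, -, -⟩ := mem_saws_iff.1 hωs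
    have hX := lastV_spec (n := n) h0
    rw [hl] at hX
    obtain ⟨hpa, hpv⟩ := prefixWalk_mem_arches3 hωh hk hX
    refine ⟨?_, hpa, twist_suffixWalk_mem hωs (by omega)⟩
    have e := visits_add_eq_left (k := k) (b := n - k) (ζ := ω)
      (fun j hj1 hjb => not_visit_of_lastV_lt (n := n) (ω := ω) (by omega) (by omega))
    rw [Nat.add_sub_cancel' (by omega : k ≤ n)] at e
    rw [hpv, e]
  have hinj : Set.InjOn g ↑F := by
    intro ω hω ω' hω' h
    simp only [hg, Prod.mk.injEq] at h
    obtain ⟨h1, h2⟩ := h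
    have hkk : ω k = ω' k := by simpa [Zd.prefixWalk] using congrFun h1 k
    have h3 : Zd.suffixWalk k (n - k) ω = Zd.suffixWalk k (n - k) ω' := by
      funext i
      have := congrFun h2 i
      rw [hkk] at this
      exact twistAt_injective _ this
    exact Zd.prefix_suffix_injOn (by omega) (saws_subset _ (hp_subset (hF ω hω).1))
      (saws_subset _ (hp_subset (hF ω' hω').1)) (Prod.ext h1 h3)
  calc ∑ ω ∈ F, y ^ visits n ω = ∑ ω ∈ F, y ^ visits k (g ω).1 :=
        Finset.sum_congr rfl fun ω hω => by rw [(hprops ω hω).1]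
    _ = ∑ p ∈ F.image g, y ^ visits k p.1 := by rw [Finset.sum_image hinj]
    _ ≤ ∑ p ∈ arches3 k ×ˢ saws (n - k), y ^ visits k p.1 := by
        refine Finset.sum_le_sum_of_subset_of_nonneg (fun p hp' => ?_) fun _ _ _ => pow_nonneg hy _
        obtain ⟨ω, hω, rfl⟩ := Finset.mem_image.1 hp'
        exact Finset.mem_product.2 ⟨(hprops ω hω).2.1, (hprops ω hω).2.2⟩
    _ = aX3w k y * #(saws (n - k)) := by
        rw [Finset.sum_product, aX3w, Finset.sum_mul]
        refine Finset.sum_congr rfl fun φ _ => ?_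
        dsimp only
        rw [Finset.sum_const, nsmul_eq_mul, mul_comm]

open Classical in
/-- **The long fibres `k ≤ m`** of the class-`A` arches of length `m+3`: weight `≤ y · X_k(y) · c_{m+2−k}(ℍ)` (alive prefix).
[cite: HammersleyTorrieWhittington1982, §2 (as summarised by Beaton 2014 arXiv v3 p. 11; locator provisional); MadrasSlade1993, §1.2, (1.2.3)] -/
theorem sum_fibA_le_X3a (m : ℕ) (hy : 0 ≤ y) {k : ℕ} (hk : k + 1 ≤ m) :
    ∑ ω ∈ fibA m k, y ^ visits (m + 3) ω ≤ y * (aX3w k y * #(saws (m + 2 - k))) := by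
  set g : (ℕ → Site 2) → (ℕ → Site 2) := fun ω => Zd.prefixWalk (m + 2) ω with hg
  have hprops : ∀ ω ∈ fibA m k, g ω ∈ (hp (m + 2)).filter (fun ξ => lastV (m + 2) ξ = k) ∧
      visits (m + 3) ω = visits (m + 2) (g ω) + 1 := by
    intro ω hω
    obtain ⟨hωh, hend, -, -, -⟩ := fibA_anatomy hω
    obtain ⟨-, hkk⟩ := Finset.mem_filter.1 hω
    obtain ⟨hph, hpv⟩ := prefixWalk_mem_hp hωh (show m + 2 ≤ m + 3 by omega)
    refine ⟨Finset.mem_filter.2 ⟨hph, (lastV_prefixWalk _ _).trans hkk⟩, ?_⟩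
    rw [show m + 3 = m + 2 + 1 by omega, visits_succ, if_pos hend, hpv]
  have hinj : Set.InjOn g ↑(fibA m k) := by
    intro ω hω ω' hω' h
    rw [Finset.mem_coe] at hω hω'
    obtain ⟨hωh, hend, -, -, -⟩ := fibA_anatomy hω
    obtain ⟨hωh', hend', -, -, -⟩ := fibA_anatomy hω'
    have hωs := hp_subset hωh
    have hωs' := hp_subset hωh'
    have hagree : ∀ i ≤ m + 2, ω i = ω' i := fun i hi => by
      have := congrFun h i
      simpa [hg, Zd.prefixWalk, min_eq_left hi] using this
    refine eq_of_agree hωs hωs' fun i hi => ?_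
    rcases Nat.lt_or_ge i (m + 3) with hi' | hi'
    · exact hagree i (by omega)
    · have hin : i = m + 3 := le_antisymm hi hi'
      rw [hin]
      obtain ⟨-, -, hbw, -⟩ := mem_saws_iff.1 hωs
      obtain ⟨-, -, hbw', -⟩ := mem_saws_iff.1 hωs'
      have hst := hbw (m + 2) (by omega)
      have hst' := hbw' (m + 2) (by omega)
      rw [show m + 2 + 1 = m + 3 by omega] at hst hst'
      rw [hagree (m + 2) le_rfl] at hst
      exact wall_nbr_unique hst hst' hend hend'
  calc ∑ ω ∈ fibA m k, y ^ visits (m + 3) ω = ∑ ω ∈ fibA m k, y * y ^ visits (m + 2) (g ω) :=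
        Finset.sum_congr rfl fun ω hω => by rw [(hprops ω hω).2, pow_succ, mul_comm]
    _ = y * ∑ ξ ∈ (fibA m k).image g, y ^ visits (m + 2) ξ := by rw [Finset.mul_sum, Finset.sum_image hinj]
    _ ≤ y * ∑ ξ ∈ (hp (m + 2)).filter (fun ξ => lastV (m + 2) ξ = k), y ^ visits (m + 2) ξ := by
        refine mul_le_mul_of_nonneg_left ?_ hy
        refine Finset.sum_le_sum_of_subset_of_nonneg (fun ξ hξ => ?_) fun _ _ _ => pow_nonneg hy _
        obtain ⟨ω, hω, rfl⟩ := Finset.mem_image.1 hξ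
        exact (hprops ω hω).1
    _ ≤ y * (aX3w k y * #(saws (m + 2 - k))) := mul_le_mul_of_nonneg_left (sum_fibre_lastV_le_X3a (n := m + 2) hy (by omega)) hy

set_option maxHeartbeats 400000 in
open Classical in
/-- **The connector fibre `k = m` injects into the alive CLASS-`B` arches of length `m`** (`y ≥ 0`): weight `≤ y · b_m(y)`.  The prefix
is class `B` because the off-wall neighbour `(1, Y_m)` of `ω_m` is `ω_{m+1}`, so `ω_{m−1}` is the dimer partner (or `m = 0`); it is alive
with witnesses `ω_{m+1}, ω_{m+2}`. [cite: EntingJensen2009, §7.4.2, Fig. 7.10; HammersleyTorrieWhittington1982, §2] -/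
theorem sum_fibA_self_le_b3W (m : ℕ) (hy : 0 ≤ y) : ∑ ω ∈ fibA m m, y ^ visits (m + 3) ω ≤ y * b3W m y := by
  set g : (ℕ → Site 2) → (ℕ → Site 2) := fun ω => Zd.prefixWalk m ω with hg
  have hcoord : ∀ ω ∈ fibA m m, ω (m + 1) 0 = 1 ∧ ω (m + 1) 1 = ω m 1 ∧ ω (m + 2) 0 = 1 ∧
      ω (m + 2) 1 = ω m 1 + (if (1 + ω m 1) % 2 = 0 then 1 else -1) ∧ ω (m + 3) 0 = 0 ∧ ω (m + 3) 1 = ω (m + 2) 1 := by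
    intro ω hω
    obtain ⟨hωh, hend, -, hk0, hoff⟩ := fibA_anatomy hω
    obtain ⟨hωs, hH⟩ := mem_hp.1 hωh
    obtain ⟨-, -, hbw, -⟩ := mem_saws_iff.1 hωs
    have h1 := hoff (m + 1) (by omega) (by omega)
    have h2 := hoff (m + 2) (by omega) le_rfl
    have hX1 := hH (m + 1) (by omega)
    have hX2 := hH (m + 2) (by omega)
    have s0 := step_cases (hbw m (by omega))
    have s1 := step_cases (hbw (m + 1) (by omega))
    have s2 := step_cases (hbw (m + 2) (by omega))
    rw [show m + 1 + 1 = m + 2 by omega] at s1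
    rw [show m + 2 + 1 = m + 3 by omega] at s2
    refine ⟨by omega, by omega, by omega, ?_, hend, by omega⟩
    split_ifs with he <;> omega
  have hprops : ∀ ω ∈ fibA m m, g ω ∈ archesB3 m ∧ visits (m + 3) ω = visits m (g ω) + 1 := by
    intro ω hω
    obtain ⟨hωh, hend, -, hk0, hoff⟩ := fibA_anatomy hω
    obtain ⟨hωs, hH⟩ := mem_hp.1 hωh
    obtain ⟨-, -, hbw, hinj⟩ := mem_saws_iff.1 hωs
    obtain ⟨hpa2, hpv⟩ := prefixWalk_mem_arches3 hωh (show m + 3 ≤ m + 3 by omega) hk0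
    obtain ⟨hpa, hal⟩ := Finset.mem_filter.1 hpa2
    have hv : ∀ i ≤ m, g ω i = ω i := fun i hi => by simp [hg, Zd.prefixWalk, min_eq_left hi]
    obtain ⟨a0, a1, -, -, -, -⟩ := hcoord ω hω
    have hclassB : g ω (m - 1) 0 = 0 := by
      rw [hv (m - 1) (by omega)]
      rcases Nat.eq_zero_or_pos m with hm0 | hm0
      · subst hm0; exact hk0
      · have sp := step_cases (hbw (m - 1) (by omega))
        rw [show m - 1 + 1 = m by omega] at sp
        by_contra hne0
        have hXp : ω (m - 1) 0 = 1 ∧ ω (m - 1) 1 = ω m 1 := by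
          have := hH (m - 1) (by omega); constructor <;> omega
        have heq : ω (m - 1) = ω (m + 1) := (site_two_eq_iff _ _).2 ⟨by omega, by omega⟩
        have := hinj (show m - 1 ∈ {j | j ≤ m + 3} by simp only [Set.mem_setOf_eq]; omega)
          (show m + 1 ∈ {j | j ≤ m + 3} by simp only [Set.mem_setOf_eq]; omega) heq
        omega
    refine ⟨Finset.mem_filter.2 ⟨hpa, hclassB, hal⟩, ?_⟩
    have h1 := hoff (m + 1) (by omega) (by omega)
    have h2 := hoff (m + 2) (by omega) le_rfl
    rw [show m + 3 = m + 2 + 1 by omega, visits_succ, if_pos hend, show m + 2 = m + 1 + 1 by omega, visits_succ, if_neg h2,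
      visits_succ, if_neg h1, hpv]
  have hinj : Set.InjOn g ↑(fibA m m) := by
    intro ω hω ω' hω' h
    rw [Finset.mem_coe] at hω hω'
    have hc := hcoord ω hω
    have hc' := hcoord ω' hω'
    have hωs := hp_subset (fibA_anatomy hω).1
    have hωs' := hp_subset (fibA_anatomy hω').1
    have hagree : ∀ i ≤ m, ω i = ω' i := fun i hi => by
      have := congrFun h i
      simpa [hg, Zd.prefixWalk, min_eq_left hi] using this
    have hYm : ω m 1 = ω' m 1 := by rw [hagree m le_rfl]
    refine eq_of_agree hωs hωs' fun i hi => ?_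
    rcases Nat.lt_or_ge i (m + 1) with hi' | hi'
    · exact hagree i (by omega)
    · rw [site_two_eq_iff]
      obtain ⟨a0, a1, b0, b1, c0, c1⟩ := hc
      obtain ⟨a0', a1', b0', b1', c0', c1'⟩ := hc'
      rw [hYm] at a1 b1
      have hcase : i = m + 1 ∨ i = m + 2 ∨ i = m + 3 := by omega
      rcases hcase with rfl | rfl | rfl
      · exact ⟨by rw [a0, a0'], by rw [a1, a1']⟩
      · exact ⟨by rw [b0, b0'], by rw [b1, b1']⟩
      · exact ⟨by rw [c0, c0'], by rw [c1, c1', b1, b1']⟩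
  calc ∑ ω ∈ fibA m m, y ^ visits (m + 3) ω = ∑ ω ∈ fibA m m, y * y ^ visits m (g ω) :=
        Finset.sum_congr rfl fun ω hω => by rw [(hprops ω hω).2, pow_succ, mul_comm]
    _ = y * ∑ ξ ∈ (fibA m m).image g, y ^ visits m ξ := by rw [Finset.mul_sum, Finset.sum_image hinj]
    _ ≤ y * b3W m y := by
        refine mul_le_mul_of_nonneg_left ?_ hy
        rw [b3W]
        refine Finset.sum_le_sum_of_subset_of_nonneg (fun ξ hξ => ?_) fun _ _ _ => pow_nonneg hy _
        obtain ⟨ω, hω, rfl⟩ := Finset.mem_image.1 hξ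
        exact (hprops ω hω).1

open Classical in
/-- **The fibre of excursion length seven weighs at most `2y · b_k(y)`** (`k ≥ 2`, `y ≥ 0`): the map `ω ↦ (ω|[0,k], [X_{k+2} = 1])` is
injective (`fibA_seven_coords₂`), the prefix is an alive CLASS-`B` arch (`ω_{k−1}` on the wall; witnesses `ω_{k+1}, ω_{k+2}`), and the
excursion adds one visit. [cite: HammersleyTorrieWhittington1982, §2 (as summarised by Beaton 2014 arXiv v3 p. 11; locator provisional); EntingJensen2009, §7.4.2, Fig. 7.10] -/
theorem sum_fibA_seven_le3 {k : ℕ} (hk : 2 ≤ k) (hy : 0 ≤ y) :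
    ∑ ω ∈ fibA (k + 4) k, y ^ visits (k + 7) ω ≤ 2 * y * b3W k y := by
  set g : (ℕ → Site 2) → (ℕ → Site 2) × Bool := fun ω => (Zd.prefixWalk k ω, decide (ω (k + 2) 0 = 1)) with hg
  have hprops : ∀ ω ∈ fibA (k + 4) k, Zd.prefixWalk k ω ∈ archesB3 k ∧ visits (k + 7) ω = visits k (Zd.prefixWalk k ω) + 1 := by
    intro ω hω
    obtain ⟨hP0, -, -⟩ := fibA_seven_coords₂ hk hω
    obtain ⟨hωh, hend, -, hk0, hoff⟩ := fibA_anatomy hω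
    rw [show k + 4 + 3 = k + 7 by omega] at hωh hend
    obtain ⟨hpa2, hpv⟩ := prefixWalk_mem_arches3 hωh (show k + 3 ≤ k + 7 by omega) hk0
    obtain ⟨hpa, hal⟩ := Finset.mem_filter.1 hpa2
    have hv : ∀ i ≤ k, Zd.prefixWalk k ω i = ω i := fun i hi => by simp [Zd.prefixWalk, min_eq_left hi]
    refine ⟨Finset.mem_filter.2 ⟨hpa, by rw [hv (k - 1) (by omega)]; exact hP0, hal⟩, ?_⟩
    have e := visits_add_eq_left (k := k) (b := 6) (ζ := ω) (fun j hj1 hj6 => hoff (k + j) (by omega) (by omega))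
    rw [show k + 7 = k + 6 + 1 by omega, visits_succ, if_pos (by rw [show k + 6 + 1 = k + 7 by omega]; exact hend), e, hpv]
  have hinj : Set.InjOn g ↑(fibA (k + 4) k) := by
    intro ω hω ω' hω' h
    rw [Finset.mem_coe] at hω hω'
    simp only [hg, Prod.mk.injEq] at h
    obtain ⟨h1, h2⟩ := h
    have hagree : ∀ i ≤ k, ω i = ω' i := fun i hi => by
      have := congrFun h1 i
      simpa [Zd.prefixWalk, min_eq_left hi] using this
    have hb : (ω (k + 2) 0 = 1) ↔ (ω' (k + 2) 0 = 1) := by simpa using h2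
    have hωs : ω ∈ saws (k + 7) := by
      have := (fibA_anatomy hω).1; rw [show k + 4 + 3 = k + 7 by omega] at this; exact hp_subset this
    have hωs' : ω' ∈ saws (k + 7) := by
      have := (fibA_anatomy hω').1; rw [show k + 4 + 3 = k + 7 by omega] at this; exact hp_subset this
    have eY : ω k 1 = ω' k 1 := by rw [hagree k le_rfl]
    have eYm : ω (k - 1) 1 = ω' (k - 1) 1 := by rw [hagree (k - 1) (by omega)]
    obtain ⟨-, ⟨hX1, hY1⟩, hc⟩ := fibA_seven_coords₂ hk hω
    obtain ⟨-, ⟨hX1', hY1'⟩, hc'⟩ := fibA_seven_coords₂ hk hω'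
    refine eq_of_agree hωs hωs' fun i hi => ?_
    rcases Nat.lt_or_ge i (k + 1) with hi' | hi'
    · exact hagree i (by omega)
    · rw [site_two_eq_iff]
      have hcase : i = k + 1 ∨ i = k + 2 ∨ i = k + 3 ∨ i = k + 4 ∨ i = k + 5 ∨ i = k + 6 ∨ i = k + 7 := by omega
      rcases hc with ⟨a0, a1, b0, b1, c0, c1, d0, d1, e0, e1, f0, f1⟩ | ⟨a0, a1, b0, b1, c0, c1, d0, d1, e0, e1, f0, f1⟩ <;>
        rcases hc' with ⟨a0', a1', b0', b1', c0', c1', d0', d1', e0', e1', f0', f1'⟩ |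
          ⟨a0', a1', b0', b1', c0', c1', d0', d1', e0', e1', f0', f1'⟩
      · rcases hcase with rfl | rfl | rfl | rfl | rfl | rfl | rfl
        · exact ⟨by rw [hX1, hX1'], by rw [hY1, hY1', eY]⟩
        · exact ⟨by rw [a0, a0'], by rw [a1, a1', eY, eYm]⟩
        · exact ⟨by rw [b0, b0'], by rw [b1, b1', eY, eYm]⟩
        · exact ⟨by rw [c0, c0'], by rw [c1, c1', eY, eYm]⟩
        · exact ⟨by rw [d0, d0'], by rw [d1, d1', eY, eYm]⟩
        · exact ⟨by rw [e0, e0'], by rw [e1, e1', eY, eYm]⟩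
        · exact ⟨by rw [f0, f0'], by rw [f1, f1', eY, eYm]⟩
      · exfalso; rw [a0, a0'] at hb; norm_num at hb
      · exfalso; rw [a0, a0'] at hb; norm_num at hb
      · rcases hcase with rfl | rfl | rfl | rfl | rfl | rfl | rfl
        · exact ⟨by rw [hX1, hX1'], by rw [hY1, hY1', eY]⟩
        · exact ⟨by rw [a0, a0'], by rw [a1, a1', eY]⟩
        · exact ⟨by rw [b0, b0'], by rw [b1, b1', eY]⟩
        · exact ⟨by rw [c0, c0'], by rw [c1, c1', eY, eYm]⟩
        · exact ⟨by rw [d0, d0'], by rw [d1, d1', eY, eYm]⟩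
        · exact ⟨by rw [e0, e0'], by rw [e1, e1', eY, eYm]⟩
        · exact ⟨by rw [f0, f0'], by rw [f1, f1', eY, eYm]⟩
  calc ∑ ω ∈ fibA (k + 4) k, y ^ visits (k + 7) ω = ∑ ω ∈ fibA (k + 4) k, y * y ^ visits k (g ω).1 :=
        Finset.sum_congr rfl fun ω hω => by simp only [hg]; rw [(hprops ω hω).2, pow_succ, mul_comm]
    _ = ∑ p ∈ (fibA (k + 4) k).image g, y * y ^ visits k p.1 := by rw [Finset.sum_image hinj]
    _ ≤ ∑ p ∈ archesB3 k ×ˢ (Finset.univ : Finset Bool), y * y ^ visits k p.1 := by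
        refine Finset.sum_le_sum_of_subset_of_nonneg (fun p hp' => ?_) fun _ _ _ => mul_nonneg hy (pow_nonneg hy _)
        obtain ⟨ω, hω, rfl⟩ := Finset.mem_image.1 hp'
        exact Finset.mem_product.2 ⟨(hprops ω hω).1, Finset.mem_univ _⟩
    _ = 2 * y * b3W k y := by
        rw [Finset.sum_product, b3W, Finset.mul_sum]
        refine Finset.sum_congr rfl fun ξ _ => ?_
        simp only [Finset.sum_const, Finset.card_univ, Fintype.card_bool, nsmul_eq_mul]
        push_cast
        ring


/-! ### §4  The launch context one step further back, and the eight-fibre (empty under three-step aliveness) -/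

/-- **Launch context, three steps back** (`k ≥ 3`): `ω_{k−3}` is `(2, Y−τ)` or `(1, Y−2τ)` (the two ways to reach `(1, Y−τ) = ω_{k−2}`).
[cite: EntingJensen2009, §7.4.2, Fig. 7.10 (brickwork form of the honeycomb lattice)] -/
theorem launch_context₃ {m k : ℕ} (hk : 3 ≤ k) (hkm : k + 1 ≤ m + 2) (hω : ω ∈ fibA m k) :
    ∃ τ : ℤ, (τ = 1 ∨ τ = -1) ∧ ω (k + 1) 0 = 1 ∧ ω (k + 1) 1 = ω k 1 ∧
      ω (k - 1) 0 = 0 ∧ ω (k - 1) 1 = ω k 1 - τ ∧ ω (k - 2) 0 = 1 ∧ ω (k - 2) 1 = ω k 1 - τ ∧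
      ((ω k 1 - τ) % 2 = 0 ↔ τ = 1) ∧
      ((ω (k - 3) 0 = 2 ∧ ω (k - 3) 1 = ω k 1 - τ) ∨ (ω (k - 3) 0 = 1 ∧ ω (k - 3) 1 = ω k 1 - 2 * τ)) := by
  obtain ⟨τ, hτ, hX1, hY1, hP0, hPY, hQ0, hQY, hpar⟩ := launch_context (by omega) hkm hω
  obtain ⟨hωh, -, -, hk0, -⟩ := fibA_anatomy hω
  obtain ⟨hωs, hH⟩ := mem_hp.1 hωh
  obtain ⟨-, -, hbw, hinj⟩ := mem_saws_iff.1 hωs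
  have hne : ∀ a b : ℕ, a ≤ m + 3 → b ≤ m + 3 → a ≠ b → ¬ (ω a 0 = ω b 0 ∧ ω a 1 = ω b 1) := by
    intro a b ha hb hab h
    have := hinj (show a ∈ {i | i ≤ m + 3} by simp only [Set.mem_setOf_eq]; exact ha)
      (show b ∈ {i | i ≤ m + 3} by simp only [Set.mem_setOf_eq]; exact hb) ((site_two_eq_iff _ _).2 h)
    exact hab this
  have hXm3 := hH (k - 3) (by omega)
  have am3 := hbw (k - 3) (by omega)
  rw [show k - 3 + 1 = k - 2 by omega] at am3
  have sm3 := step_cases am3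
  have h31 := hne (k - 3) (k - 1) (by omega) (by omega) (by omega)
  refine ⟨τ, hτ, hX1, hY1, hP0, hPY, hQ0, hQY, hpar, ?_⟩
  rcases hτ with hτ | hτ <;> subst hτ <;> omega

/-- Eight-fibre, dead branch 1a: after the skip start `(1,Y+τ)(2,Y+τ)(3,Y+τ)` the walk cannot be at `X = 1` at time `k+7`.
[cite: EntingJensen2009, §7.4.2, Fig. 7.10] -/
theorem fibA_eight_dead_1a {k : ℕ} (hω : ω ∈ fibA (k + 5) k) {τ : ℤ} (hτ : τ = 1 ∨ τ = -1)
    (hpar : (ω k 1 - τ) % 2 = 0 ↔ τ = 1) (hX1 : ω (k + 1) 0 = 1 ∧ ω (k + 1) 1 = ω k 1)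
    (hX3 : ω (k + 3) 0 = 2 ∧ ω (k + 3) 1 = ω k 1 + τ) (hX4 : ω (k + 4) 0 = 3 ∧ ω (k + 4) 1 = ω k 1 + τ) : False := by
  obtain ⟨hωh, hend, -, hk0, hoff⟩ := fibA_anatomy hω
  rw [show k + 5 + 3 = k + 8 by omega] at hωh hend
  obtain ⟨hωs, hH⟩ := mem_hp.1 hωh
  obtain ⟨-, -, hbw, hinj⟩ := mem_saws_iff.1 hωs
  have hne : ∀ a b : ℕ, a ≤ k + 8 → b ≤ k + 8 → a ≠ b → ¬ (ω a 0 = ω b 0 ∧ ω a 1 = ω b 1) := by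
    intro a b ha hb hab h
    have := hinj (show a ∈ {i | i ≤ k + 8} by simp only [Set.mem_setOf_eq]; exact ha)
      (show b ∈ {i | i ≤ k + 8} by simp only [Set.mem_setOf_eq]; exact hb) ((site_two_eq_iff _ _).2 h)
    exact hab this
  have h3 := hoff (k + 3) (by omega) (by omega)
  have h4 := hoff (k + 4) (by omega) (by omega)
  have h5 := hoff (k + 5) (by omega) (by omega)
  have h6 := hoff (k + 6) (by omega) (by omega)
  have h7 := hoff (k + 7) (by omega) (by omega)
  have hX7n := hH (k + 7) (by omega)
  have hX6n := hH (k + 6) (by omega)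
  have hX5n := hH (k + 5) (by omega)
  have s2 := step_cases (hbw (k + 2) (by omega))
  rw [show k + 2 + 1 = k + 3 by omega] at s2
  have s3 := step_cases (hbw (k + 3) (by omega))
  rw [show k + 3 + 1 = k + 4 by omega] at s3
  have s4 := step_cases (hbw (k + 4) (by omega))
  rw [show k + 4 + 1 = k + 5 by omega] at s4
  have s5 := step_cases (hbw (k + 5) (by omega))
  rw [show k + 5 + 1 = k + 6 by omega] at s5
  have s6 := step_cases (hbw (k + 6) (by omega))
  rw [show k + 6 + 1 = k + 7 by omega] at s6
  have s7 := step_cases (hbw (k + 7) (by omega))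
  rw [show k + 7 + 1 = k + 8 by omega] at s7
  -- `X_{k+7} = 1`, `X_{k+6} ∈ {1, 2}`
  have hX7 : ω (k + 7) 0 = 1 := by clear s2 s3 s4 s5 s6; omega
  have hX6 : ω (k + 6) 0 = 1 ∨ ω (k + 6) 0 = 2 := by clear s2 s3 s4 s5 s7; omega
  clear s7
  clear s2 s3
  have h53 := hne (k + 5) (k + 3) (by omega) (by omega) (by omega)
  have h71 := hne (k + 7) (k + 1) (by omega) (by omega) (by omega)
  obtain ⟨hx1, hy1⟩ := hX1
  obtain ⟨hx3, hy3⟩ := hX3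
  obtain ⟨hx4, hy4⟩ := hX4
  have hD : ω (k + 5) 0 = 4 ∨ (ω (k + 5) 0 = 3 ∧ ω (k + 5) 1 = ω k 1) := by
    clear s5 s6 h71 hX7 hX6
    rcases hτ with hτ | hτ <;> (subst hτ; omega)
  clear s4 h53
  rcases hD with hx5 | ⟨hx5, hy5⟩
  · clear s6 h71 hX7 hpar; omega
  · have hE : ω (k + 6) 0 = 2 ∧ ω (k + 6) 1 = ω k 1 := by
      clear s6 h71 hX7 hpar; constructor <;> omega
    clear s5 hX6
    rcases hτ with hτ | hτ <;> (subst hτ; omega)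

/-- Eight-fibre, dead branch 1b: after `(1,Y+τ)(2,Y+τ)(2,Y+2τ)` the walk cannot be at `X = 1` at time `k+7` (the vertical bond at
`(1,Y+3τ)` leads back to `ω_{k+5}`). [cite: EntingJensen2009, §7.4.2, Fig. 7.10] -/
theorem fibA_eight_dead_1b {k : ℕ} (hω : ω ∈ fibA (k + 5) k) {τ : ℤ} (hτ : τ = 1 ∨ τ = -1)
    (hpar : (ω k 1 - τ) % 2 = 0 ↔ τ = 1)
    (hX3 : ω (k + 3) 0 = 2 ∧ ω (k + 3) 1 = ω k 1 + τ) (hX4 : ω (k + 4) 0 = 2 ∧ ω (k + 4) 1 = ω k 1 + 2 * τ) : False := by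
  obtain ⟨hωh, hend, -, hk0, hoff⟩ := fibA_anatomy hω
  rw [show k + 5 + 3 = k + 8 by omega] at hωh hend
  obtain ⟨hωs, hH⟩ := mem_hp.1 hωh
  obtain ⟨-, -, hbw, hinj⟩ := mem_saws_iff.1 hωs
  have hne : ∀ a b : ℕ, a ≤ k + 8 → b ≤ k + 8 → a ≠ b → ¬ (ω a 0 = ω b 0 ∧ ω a 1 = ω b 1) := by
    intro a b ha hb hab h
    have := hinj (show a ∈ {i | i ≤ k + 8} by simp only [Set.mem_setOf_eq]; exact ha)
      (show b ∈ {i | i ≤ k + 8} by simp only [Set.mem_setOf_eq]; exact hb) ((site_two_eq_iff _ _).2 h)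
    exact hab this
  have h3 := hoff (k + 3) (by omega) (by omega)
  have h4 := hoff (k + 4) (by omega) (by omega)
  have h5 := hoff (k + 5) (by omega) (by omega)
  have h6 := hoff (k + 6) (by omega) (by omega)
  have h7 := hoff (k + 7) (by omega) (by omega)
  have hX7n := hH (k + 7) (by omega)
  have hX6n := hH (k + 6) (by omega)
  have hX5n := hH (k + 5) (by omega)
  have s2 := step_cases (hbw (k + 2) (by omega))
  rw [show k + 2 + 1 = k + 3 by omega] at s2
  have s3 := step_cases (hbw (k + 3) (by omega))
  rw [show k + 3 + 1 = k + 4 by omega] at s3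
  have s4 := step_cases (hbw (k + 4) (by omega))
  rw [show k + 4 + 1 = k + 5 by omega] at s4
  have s5 := step_cases (hbw (k + 5) (by omega))
  rw [show k + 5 + 1 = k + 6 by omega] at s5
  have s6 := step_cases (hbw (k + 6) (by omega))
  rw [show k + 6 + 1 = k + 7 by omega] at s6
  have s7 := step_cases (hbw (k + 7) (by omega))
  rw [show k + 7 + 1 = k + 8 by omega] at s7
  -- `X_{k+7} = 1`, `X_{k+6} ∈ {1, 2}`
  have hX7 : ω (k + 7) 0 = 1 := by clear s2 s3 s4 s5 s6; omega
  have hX6 : ω (k + 6) 0 = 1 ∨ ω (k + 6) 0 = 2 := by clear s2 s3 s4 s5 s7; omega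
  clear s7
  clear s2 s3
  have h53 := hne (k + 5) (k + 3) (by omega) (by omega) (by omega)
  have h64 := hne (k + 6) (k + 4) (by omega) (by omega) (by omega)
  have h75 := hne (k + 7) (k + 5) (by omega) (by omega) (by omega)
  obtain ⟨hx3, hy3⟩ := hX3
  obtain ⟨hx4, hy4⟩ := hX4
  have hD : (ω (k + 5) 0 = 3 ∧ ω (k + 5) 1 = ω k 1 + 2 * τ) ∨ (ω (k + 5) 0 = 1 ∧ ω (k + 5) 1 = ω k 1 + 2 * τ) := by
    clear s5 s6 h64 h75 hX7 hX6
    rcases hτ with hτ | hτ <;> (subst hτ; omega)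
  clear s4 h53
  rcases hD with ⟨hx5, hy5⟩ | ⟨hx5, hy5⟩
  · clear s6 h75 hX7 hpar; omega
  · have hE : ω (k + 6) 0 = 1 ∧ ω (k + 6) 1 = ω k 1 + 3 * τ := by
      clear s6 h75 hX7
      rcases hτ with hτ | hτ <;> (subst hτ; constructor <;> omega)
    obtain ⟨hx6, hy6⟩ := hE
    clear s5 h64 hX6
    rcases hτ with hτ | hτ <;> (subst hτ; omega)

/-- Eight-fibre, dead branch 2: after `(2,Y)` the turn `(2,Y−τ)` towards the partner side meets `ω_{k−3}` — at once if
`ω_{k−3} = (2,Y−τ)`, or after the forced chain `(3,Y−τ)(3,Y−2τ)(2,Y−2τ)(1,Y−2τ)` if `ω_{k−3} = (1,Y−2τ)`.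
[cite: EntingJensen2009, §7.4.2, Fig. 7.10] -/
theorem fibA_eight_dead_2 {k : ℕ} (hk : 3 ≤ k) (hω : ω ∈ fibA (k + 5) k) {τ : ℤ} (hτ : τ = 1 ∨ τ = -1)
    (hpar : (ω k 1 - τ) % 2 = 0 ↔ τ = 1) (hQ : ω (k - 2) 0 = 1 ∧ ω (k - 2) 1 = ω k 1 - τ)
    (hctx : (ω (k - 3) 0 = 2 ∧ ω (k - 3) 1 = ω k 1 - τ) ∨ (ω (k - 3) 0 = 1 ∧ ω (k - 3) 1 = ω k 1 - 2 * τ))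
    (hX2 : ω (k + 2) 0 = 2 ∧ ω (k + 2) 1 = ω k 1) (hX3 : ω (k + 3) 0 = 2 ∧ ω (k + 3) 1 = ω k 1 - τ) : False := by
  obtain ⟨hωh, hend, -, hk0, hoff⟩ := fibA_anatomy hω
  rw [show k + 5 + 3 = k + 8 by omega] at hωh hend
  obtain ⟨hωs, hH⟩ := mem_hp.1 hωh
  obtain ⟨-, -, hbw, hinj⟩ := mem_saws_iff.1 hωs
  have hne : ∀ a b : ℕ, a ≤ k + 8 → b ≤ k + 8 → a ≠ b → ¬ (ω a 0 = ω b 0 ∧ ω a 1 = ω b 1) := by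
    intro a b ha hb hab h
    have := hinj (show a ∈ {i | i ≤ k + 8} by simp only [Set.mem_setOf_eq]; exact ha)
      (show b ∈ {i | i ≤ k + 8} by simp only [Set.mem_setOf_eq]; exact hb) ((site_two_eq_iff _ _).2 h)
    exact hab this
  have h3 := hoff (k + 3) (by omega) (by omega)
  have h4 := hoff (k + 4) (by omega) (by omega)
  have h5 := hoff (k + 5) (by omega) (by omega)
  have h6 := hoff (k + 6) (by omega) (by omega)
  have h7 := hoff (k + 7) (by omega) (by omega)
  have hX7n := hH (k + 7) (by omega)
  have hX6n := hH (k + 6) (by omega)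
  have hX5n := hH (k + 5) (by omega)
  have s2 := step_cases (hbw (k + 2) (by omega))
  rw [show k + 2 + 1 = k + 3 by omega] at s2
  have s3 := step_cases (hbw (k + 3) (by omega))
  rw [show k + 3 + 1 = k + 4 by omega] at s3
  have s4 := step_cases (hbw (k + 4) (by omega))
  rw [show k + 4 + 1 = k + 5 by omega] at s4
  have s5 := step_cases (hbw (k + 5) (by omega))
  rw [show k + 5 + 1 = k + 6 by omega] at s5
  have s6 := step_cases (hbw (k + 6) (by omega))
  rw [show k + 6 + 1 = k + 7 by omega] at s6
  have s7 := step_cases (hbw (k + 7) (by omega))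
  rw [show k + 7 + 1 = k + 8 by omega] at s7
  -- `X_{k+7} = 1`, `X_{k+6} ∈ {1, 2}`
  have hX7 : ω (k + 7) 0 = 1 := by clear s2 s3 s4 s5 s6; omega
  have hX6 : ω (k + 6) 0 = 1 ∨ ω (k + 6) 0 = 2 := by clear s2 s3 s4 s5 s7; omega
  clear s7
  clear s2
  have h3m3 := hne (k + 3) (k - 3) (by omega) (by omega) (by omega)
  have h7m3 := hne (k + 7) (k - 3) (by omega) (by omega) (by omega)
  have h4m2 := hne (k + 4) (k - 2) (by omega) (by omega) (by omega)
  have h42 := hne (k + 4) (k + 2) (by omega) (by omega) (by omega)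
  have h53 := hne (k + 5) (k + 3) (by omega) (by omega) (by omega)
  have h64 := hne (k + 6) (k + 4) (by omega) (by omega) (by omega)
  obtain ⟨hx2, hy2⟩ := hX2
  obtain ⟨hx3, hy3⟩ := hX3
  obtain ⟨hq0, hq1⟩ := hQ
  rcases hctx with ⟨hc0, hc1⟩ | ⟨hc0, hc1⟩
  · exact h3m3 ⟨by omega, by omega⟩
  · have hC : ω (k + 4) 0 = 3 ∧ ω (k + 4) 1 = ω k 1 - τ := by
      clear s4 s5 s6 h53 h64 h7m3 hX7 hX6
      rcases hτ with hτ | hτ <;> (subst hτ; constructor <;> omega)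
    obtain ⟨hx4, hy4⟩ := hC
    clear s3 h42 h4m2 h3m3
    have hD : ω (k + 5) 0 = 4 ∨ (ω (k + 5) 0 = 3 ∧ ω (k + 5) 1 = ω k 1 - 2 * τ) := by
      clear s5 s6 h64 h7m3 hX7 hX6
      rcases hτ with hτ | hτ <;> (subst hτ; omega)
    clear s4 h53
    rcases hD with hx5 | ⟨hx5, hy5⟩
    · clear s6 h7m3 hX7 hpar hc1 hq1; omega
    · have hE : ω (k + 6) 0 = 2 ∧ ω (k + 6) 1 = ω k 1 - 2 * τ := by
        clear s6 h7m3 hX7 hpar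
        constructor <;> omega
      obtain ⟨hx6, hy6⟩ := hE
      clear s5 h64 hX6
      have hF : ω (k + 7) 1 = ω k 1 - 2 * τ := by clear h7m3 hpar; omega
      exact h7m3 ⟨by omega, by omega⟩

set_option maxHeartbeats 400000 in
/-- **The eight-fibre, first half** (`k ≥ 3`): `X_{k+7} = 1` and the excursion starts `(2,Y)(3,Y)`.
[cite: EntingJensen2009, §7.4.2, Fig. 7.10] -/
theorem fibA_eight_head {k : ℕ} (hk : 3 ≤ k) (hω : ω ∈ fibA (k + 5) k) :
    ∃ τ : ℤ, (τ = 1 ∨ τ = -1) ∧ ((ω k 1 - τ) % 2 = 0 ↔ τ = 1) ∧ ω (k + 7) 0 = 1 ∧ (ω (k + 6) 0 = 1 ∨ ω (k + 6) 0 = 2) ∧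
      (ω (k + 2) 0 = 2 ∧ ω (k + 2) 1 = ω k 1) ∧ (ω (k + 3) 0 = 3 ∧ ω (k + 3) 1 = ω k 1) := by
  obtain ⟨τ, hτ, hX1, hY1, hP0, hPY, hQ0, hQY, hpar, hctx⟩ := launch_context₃ hk (by omega) hω
  obtain ⟨hωh, hend, -, hk0, hoff⟩ := fibA_anatomy hω
  rw [show k + 5 + 3 = k + 8 by omega] at hωh hend
  obtain ⟨hωs, hH⟩ := mem_hp.1 hωh
  obtain ⟨-, -, hbw, hinj⟩ := mem_saws_iff.1 hωs
  have hne : ∀ a b : ℕ, a ≤ k + 8 → b ≤ k + 8 → a ≠ b → ¬ (ω a 0 = ω b 0 ∧ ω a 1 = ω b 1) := by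
    intro a b ha hb hab h
    have := hinj (show a ∈ {i | i ≤ k + 8} by simp only [Set.mem_setOf_eq]; exact ha)
      (show b ∈ {i | i ≤ k + 8} by simp only [Set.mem_setOf_eq]; exact hb) ((site_two_eq_iff _ _).2 h)
    exact hab this
  have h3 := hoff (k + 3) (by omega) (by omega)
  have h4 := hoff (k + 4) (by omega) (by omega)
  have h5 := hoff (k + 5) (by omega) (by omega)
  have h6 := hoff (k + 6) (by omega) (by omega)
  have h7 := hoff (k + 7) (by omega) (by omega)
  have hX7n := hH (k + 7) (by omega)
  have hX6n := hH (k + 6) (by omega)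
  have hX5n := hH (k + 5) (by omega)
  have s2 := step_cases (hbw (k + 2) (by omega))
  rw [show k + 2 + 1 = k + 3 by omega] at s2
  have s3 := step_cases (hbw (k + 3) (by omega))
  rw [show k + 3 + 1 = k + 4 by omega] at s3
  have s4 := step_cases (hbw (k + 4) (by omega))
  rw [show k + 4 + 1 = k + 5 by omega] at s4
  have s5 := step_cases (hbw (k + 5) (by omega))
  rw [show k + 5 + 1 = k + 6 by omega] at s5
  have s6 := step_cases (hbw (k + 6) (by omega))
  rw [show k + 6 + 1 = k + 7 by omega] at s6
  have s7 := step_cases (hbw (k + 7) (by omega))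
  rw [show k + 7 + 1 = k + 8 by omega] at s7
  -- `X_{k+7} = 1`, `X_{k+6} ∈ {1, 2}`
  have hX7 : ω (k + 7) 0 = 1 := by clear s2 s3 s4 s5 s6; omega
  have hX6 : ω (k + 6) 0 = 1 ∨ ω (k + 6) 0 = 2 := by clear s2 s3 s4 s5 s7; omega
  clear s7
  have h2 := hoff (k + 2) (by omega) (by omega)
  have s1 := step_cases (hbw (k + 1) (by omega))
  rw [show k + 1 + 1 = k + 2 by omega] at s1
  have h31 := hne (k + 3) (k + 1) (by omega) (by omega) (by omega)
  have h42 := hne (k + 4) (k + 2) (by omega) (by omega) (by omega)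
  -- step `k+2`
  have hA : (ω (k + 2) 0 = 2 ∧ ω (k + 2) 1 = ω k 1) ∨ (ω (k + 2) 0 = 1 ∧ ω (k + 2) 1 = ω k 1 + τ) := by
    clear s2 s3 s4 s5 s6 h31 h42 hX7 hX6 hctx
    rcases hτ with hτ | hτ <;> (subst hτ; omega)
  clear s1
  rcases hA with ⟨hx2, hy2⟩ | ⟨hx2, hy2⟩
  · -- `(2,Y)`: step `k+3` is `(3,Y)` or the turn `(2,Y−τ)`
    have hB : (ω (k + 3) 0 = 3 ∧ ω (k + 3) 1 = ω k 1) ∨ (ω (k + 3) 0 = 2 ∧ ω (k + 3) 1 = ω k 1 - τ) := by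
      clear s3 s4 s5 s6 h42 hX7 hX6 hctx
      rcases hτ with hτ | hτ <;> (subst hτ; omega)
    rcases hB with hB | hB
    · exact ⟨τ, hτ, hpar, hX7, hX6, ⟨hx2, hy2⟩, hB⟩
    · exact (fibA_eight_dead_2 hk hω hτ hpar ⟨hQ0, hQY⟩ hctx ⟨hx2, hy2⟩ hB).elim
  · -- the skip start: `(2,Y+τ)` forced, then `(3,Y+τ)` or `(2,Y+2τ)`, both dead
    exfalso
    have hX3 : ω (k + 3) 0 = 2 ∧ ω (k + 3) 1 = ω k 1 + τ := by
      clear s3 s4 s5 s6 h42 hX7 hX6 hctx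
      rcases hτ with hτ | hτ <;> (subst hτ; constructor <;> omega)
    clear s2 h31
    have hC : (ω (k + 4) 0 = 3 ∧ ω (k + 4) 1 = ω k 1 + τ) ∨ (ω (k + 4) 0 = 2 ∧ ω (k + 4) 1 = ω k 1 + 2 * τ) := by
      clear s4 s5 s6 hX7 hX6 hctx
      rcases hτ with hτ | hτ <;> (subst hτ; omega)
    rcases hC with hC | hC
    · exact fibA_eight_dead_1a hω hτ hpar ⟨hX1, hY1⟩ hX3 hC
    · exact fibA_eight_dead_1b hω hτ hpar hX3 hC

set_option maxHeartbeats 400000 in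
/-- **The eight-fibre: the unique shape** (`k ≥ 3`): `(1,Y)(2,Y)(3,Y)(3,Y+τ)(2,Y+τ)(2,Y+2τ)(1,Y+2τ)(0,Y+2τ)` — around the brick to
the right, then the skip of the dimer `(0,Y+τ)`. [cite: EntingJensen2009, §7.4.2, Fig. 7.10] -/
theorem fibA_eight_coords {k : ℕ} (hk : 3 ≤ k) (hω : ω ∈ fibA (k + 5) k) :
    ∃ τ : ℤ, (τ = 1 ∨ τ = -1) ∧ ((ω k 1 - τ) % 2 = 0 ↔ τ = 1) ∧ (ω (k + 1) 0 = 1 ∧ ω (k + 1) 1 = ω k 1) ∧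
      (ω (k + 4) 0 = 3 ∧ ω (k + 4) 1 = ω k 1 + τ) ∧ (ω (k + 5) 0 = 2 ∧ ω (k + 5) 1 = ω k 1 + τ) ∧
      (ω (k + 7) 0 = 1 ∧ ω (k + 7) 1 = ω k 1 + 2 * τ) ∧ (ω (k + 8) 0 = 0 ∧ ω (k + 8) 1 = ω k 1 + 2 * τ) := by
  obtain ⟨τ, hτ, hpar, -, -, hX2, hX3⟩ := fibA_eight_head hk hω
  obtain ⟨τ', -, hX1, hY1, -, -, -, -, hpar'⟩ := launch_context (by omega : 2 ≤ k) (by omega : k + 1 ≤ k + 5 + 2) hω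
  obtain ⟨hωh, hend, -, hk0, hoff⟩ := fibA_anatomy hω
  rw [show k + 5 + 3 = k + 8 by omega] at hωh hend
  obtain ⟨hωs, hH⟩ := mem_hp.1 hωh
  obtain ⟨-, -, hbw, hinj⟩ := mem_saws_iff.1 hωs
  have hne : ∀ a b : ℕ, a ≤ k + 8 → b ≤ k + 8 → a ≠ b → ¬ (ω a 0 = ω b 0 ∧ ω a 1 = ω b 1) := by
    intro a b ha hb hab h
    have := hinj (show a ∈ {i | i ≤ k + 8} by simp only [Set.mem_setOf_eq]; exact ha)
      (show b ∈ {i | i ≤ k + 8} by simp only [Set.mem_setOf_eq]; exact hb) ((site_two_eq_iff _ _).2 h)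
    exact hab this
  have h3 := hoff (k + 3) (by omega) (by omega)
  have h4 := hoff (k + 4) (by omega) (by omega)
  have h5 := hoff (k + 5) (by omega) (by omega)
  have h6 := hoff (k + 6) (by omega) (by omega)
  have h7 := hoff (k + 7) (by omega) (by omega)
  have hX7n := hH (k + 7) (by omega)
  have hX6n := hH (k + 6) (by omega)
  have hX5n := hH (k + 5) (by omega)
  have s2 := step_cases (hbw (k + 2) (by omega))
  rw [show k + 2 + 1 = k + 3 by omega] at s2
  have s3 := step_cases (hbw (k + 3) (by omega))
  rw [show k + 3 + 1 = k + 4 by omega] at s3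
  have s4 := step_cases (hbw (k + 4) (by omega))
  rw [show k + 4 + 1 = k + 5 by omega] at s4
  have s5 := step_cases (hbw (k + 5) (by omega))
  rw [show k + 5 + 1 = k + 6 by omega] at s5
  have s6 := step_cases (hbw (k + 6) (by omega))
  rw [show k + 6 + 1 = k + 7 by omega] at s6
  have s7 := step_cases (hbw (k + 7) (by omega))
  rw [show k + 7 + 1 = k + 8 by omega] at s7
  -- `X_{k+7} = 1`, `X_{k+6} ∈ {1, 2}`
  have hX7 : ω (k + 7) 0 = 1 := by clear s2 s3 s4 s5 s6; omega
  have hX6 : ω (k + 6) 0 = 1 ∨ ω (k + 6) 0 = 2 := by clear s2 s3 s4 s5 s7; omega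
  clear s7
  clear s2
  obtain ⟨hx2, hy2⟩ := hX2
  obtain ⟨hx3, hy3⟩ := hX3
  have h42 := hne (k + 4) (k + 2) (by omega) (by omega) (by omega)
  have h53 := hne (k + 5) (k + 3) (by omega) (by omega) (by omega)
  have h64 := hne (k + 6) (k + 4) (by omega) (by omega) (by omega)
  have h71 := hne (k + 7) (k + 1) (by omega) (by omega) (by omega)
  have h75 := hne (k + 7) (k + 5) (by omega) (by omega) (by omega)
  -- `k+4`: `(4,Y)` dies (`X_{k+6} ∉ {1,2}`), so `(3,Y+τ)`
  have hC : (ω (k + 4) 0 = 4 ∧ ω (k + 4) 1 = ω k 1) ∨ (ω (k + 4) 0 = 3 ∧ ω (k + 4) 1 = ω k 1 + τ) := by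
    clear s4 s5 s6 h53 h64 h71 h75 hX7 hX6
    rcases hτ with hτ | hτ <;> (subst hτ; omega)
  clear s3 h42
  have hnot4 : ¬ (ω (k + 4) 0 = 4 ∧ ω (k + 4) 1 = ω k 1) := by
    rintro ⟨hx4, hy4⟩
    have : ω (k + 5) 0 = 5 ∨ ω (k + 5) 0 = 4 := by clear s5 s6 h64 h71 h75 hX7 hX6 hpar hpar'; omega
    clear s4 h53 hpar hpar'
    omega
  have hX4 := hC.resolve_left hnot4
  obtain ⟨hx4, hy4⟩ := hX4
  clear hC hnot4
  -- `k+5`: `(4,Y+τ)` dies, the vertical back is used, so `(2,Y+τ)`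
  have hD : ω (k + 5) 0 = 4 ∨ (ω (k + 5) 0 = 2 ∧ ω (k + 5) 1 = ω k 1 + τ) := by
    clear s5 s6 h64 h71 h75 hX7 hX6
    rcases hτ with hτ | hτ <;> (subst hτ; omega)
  clear s4 h53
  have hnot5 : ω (k + 5) 0 ≠ 4 := by
    intro hx5; clear s6 h71 h75 hX7 hpar hpar' hD; omega
  have hX5 := hD.resolve_left hnot5
  obtain ⟨hx5, hy5⟩ := hX5
  clear hD hnot5
  -- `k+6`: `(1,Y+τ)` would force `ω_{k+7} = (1,Y) = ω_{k+1}`; so `(2,Y+2τ)`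
  have hE : (ω (k + 6) 0 = 1 ∧ ω (k + 6) 1 = ω k 1 + τ) ∨ (ω (k + 6) 0 = 2 ∧ ω (k + 6) 1 = ω k 1 + 2 * τ) := by
    clear s6 h71 h75 hX7
    rcases hτ with hτ | hτ <;> (subst hτ; omega)
  clear s5 h64 hX6
  have hnot6 : ¬ (ω (k + 6) 0 = 1 ∧ ω (k + 6) 1 = ω k 1 + τ) := by
    rintro ⟨hx6, hy6⟩
    clear hE h75
    rcases hτ with hτ | hτ <;> (subst hτ; omega)
  have hX6' := hE.resolve_left hnot6
  obtain ⟨hx6, hy6⟩ := hX6'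
  clear hE hnot6
  have hY7 : ω (k + 7) 1 = ω k 1 + 2 * τ := by
    clear h71
    rcases hτ with hτ | hτ <;> (subst hτ; omega)
  refine ⟨τ, hτ, hpar, ⟨hX1, hY1⟩, ⟨hx4, hy4⟩, ⟨hx5, hy5⟩, ⟨hX7, hY7⟩, hend, ?_⟩
  have s7 := step_cases (hbw (k + 7) (by omega))
  rw [show k + 7 + 1 = k + 8 by omega] at s7
  clear s6 h71 h75
  omega

/-- ★★ **The eight-fibre is NOT three-step alive** (`k ≥ 3`): the end `(0,Y+2τ)` sees only the skipped wall vertex `(0,Y+τ)`, from which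
only `(1,Y+τ)` is fresh, whose remaining neighbours `(2,Y+τ) = ω_{k+5}` and `(1,Y) = ω_{k+1}` are used.
[cite: EntingJensen2009, §7.4.2, Fig. 7.10; HammersleyTorrieWhittington1982, §2] -/
theorem not_alive3_of_mem_fibA_eight {k : ℕ} (hk : 3 ≤ k) (hω : ω ∈ fibA (k + 5) k) : ¬ Alive3 (k + 8) ω := by
  obtain ⟨τ, hτ, hpar, ⟨hX1, hY1⟩, -, ⟨hx5, hy5⟩, ⟨hX7, hY7⟩, ⟨hend, hY8⟩⟩ := fibA_eight_coords hk hω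
  rintro ⟨z₁, z₂, z₃, hz1, hz2, hz3, h13, hz1n, hz2n, hz3n, hfresh⟩
  rw [brickWallGraph_adj_coord] at hz1 hz2 hz3
  obtain ⟨f7a, -, -⟩ := hfresh (k + 7) (by omega)
  obtain ⟨-, f8b, -⟩ := hfresh (k + 8) le_rfl
  obtain ⟨-, -, f5c⟩ := hfresh (k + 5) (by omega)
  obtain ⟨-, -, f1c⟩ := hfresh (k + 1) (by omega)
  have a7 : ¬ (ω (k + 7) 0 = z₁ 0 ∧ ω (k + 7) 1 = z₁ 1) := fun h => f7a ((site_two_eq_iff _ _).2 h)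
  have b8 : ¬ (ω (k + 8) 0 = z₂ 0 ∧ ω (k + 8) 1 = z₂ 1) := fun h => f8b ((site_two_eq_iff _ _).2 h)
  have c5 : ¬ (ω (k + 5) 0 = z₃ 0 ∧ ω (k + 5) 1 = z₃ 1) := fun h => f5c ((site_two_eq_iff _ _).2 h)
  have c1 : ¬ (ω (k + 1) 0 = z₃ 0 ∧ ω (k + 1) 1 = z₃ 1) := fun h => f1c ((site_two_eq_iff _ _).2 h)
  have h13' : ¬ (z₁ 0 = z₃ 0 ∧ z₁ 1 = z₃ 1) := fun h => h13 ((site_two_eq_iff _ _).2 h)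
  have hz1c : z₁ 0 = 0 ∧ z₁ 1 = ω k 1 + τ := by
    clear hz2 hz3 b8 c5 c1 h13' hz2n hz3n
    rcases hτ with hτ | hτ <;> (subst hτ; constructor <;> omega)
  obtain ⟨hz1x, hz1y⟩ := hz1c
  clear hz1 a7
  have hz2c : z₂ 0 = 1 ∧ z₂ 1 = ω k 1 + τ := by
    clear hz3 c5 c1 h13' hz3n
    rcases hτ with hτ | hτ <;> (subst hτ; constructor <;> omega)
  obtain ⟨hz2x, hz2y⟩ := hz2c
  clear hz2 b8
  rcases hτ with hτ | hτ <;> (subst hτ; omega)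

/-! ### §5  The nine-fibre: exactly the two shapes of `Defect.nineA` / `Defect.nineB` (the third, downward one is not two-step alive) -/

/-- Nine-fibre, dead branch S1a: `(1,Y+τ)(2,Y+τ)(2,Y+2τ)(1,Y+2τ)` forces `(1,Y+3τ)(2,Y+3τ)` and no site with `X = 1` is left for time `k+8`.
[cite: EntingJensen2009, §7.4.2, Fig. 7.10] -/
theorem fibA_nine_dead_S1a {k : ℕ} (hω : ω ∈ fibA (k + 6) k) {τ : ℤ} (hτ : τ = 1 ∨ τ = -1)
    (hpar : (ω k 1 - τ) % 2 = 0 ↔ τ = 1) (hX4 : ω (k + 4) 0 = 2 ∧ ω (k + 4) 1 = ω k 1 + 2 * τ)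
    (hX5 : ω (k + 5) 0 = 1 ∧ ω (k + 5) 1 = ω k 1 + 2 * τ) : False := by
  obtain ⟨hωh, hend, -, hk0, hoff⟩ := fibA_anatomy hω
  rw [show k + 6 + 3 = k + 9 by omega] at hωh hend
  obtain ⟨hωs, hH⟩ := mem_hp.1 hωh
  obtain ⟨-, -, hbw, hinj⟩ := mem_saws_iff.1 hωs
  have hne : ∀ a b : ℕ, a ≤ k + 9 → b ≤ k + 9 → a ≠ b → ¬ (ω a 0 = ω b 0 ∧ ω a 1 = ω b 1) := by
    intro a b ha hb hab h
    have := hinj (show a ∈ {i | i ≤ k + 9} by simp only [Set.mem_setOf_eq]; exact ha)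
      (show b ∈ {i | i ≤ k + 9} by simp only [Set.mem_setOf_eq]; exact hb) ((site_two_eq_iff _ _).2 h)
    exact hab this
  have h3 := hoff (k + 3) (by omega) (by omega)
  have h4 := hoff (k + 4) (by omega) (by omega)
  have h5 := hoff (k + 5) (by omega) (by omega)
  have h6 := hoff (k + 6) (by omega) (by omega)
  have h7 := hoff (k + 7) (by omega) (by omega)
  have h8 := hoff (k + 8) (by omega) (by omega)
  have hX8n := hH (k + 8) (by omega)
  have hX7n := hH (k + 7) (by omega)
  have hX6n := hH (k + 6) (by omega)
  have hX5n := hH (k + 5) (by omega)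
  have s2 := step_cases (hbw (k + 2) (by omega))
  rw [show k + 2 + 1 = k + 3 by omega] at s2
  have s3 := step_cases (hbw (k + 3) (by omega))
  rw [show k + 3 + 1 = k + 4 by omega] at s3
  have s4 := step_cases (hbw (k + 4) (by omega))
  rw [show k + 4 + 1 = k + 5 by omega] at s4
  have s5 := step_cases (hbw (k + 5) (by omega))
  rw [show k + 5 + 1 = k + 6 by omega] at s5
  have s6 := step_cases (hbw (k + 6) (by omega))
  rw [show k + 6 + 1 = k + 7 by omega] at s6
  have s7 := step_cases (hbw (k + 7) (by omega))
  rw [show k + 7 + 1 = k + 8 by omega] at s7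
  have s8 := step_cases (hbw (k + 8) (by omega))
  rw [show k + 8 + 1 = k + 9 by omega] at s8
  -- `X_{k+8} = 1`, `X_{k+7} ∈ {1, 2}`
  have hX8 : ω (k + 8) 0 = 1 := by clear s2 s3 s4 s5 s6 s7; omega
  have hX7 : ω (k + 7) 0 = 1 ∨ ω (k + 7) 0 = 2 := by clear s2 s3 s4 s5 s6 s8; omega
  clear s2 s3 s4 s8
  have h64 := hne (k + 6) (k + 4) (by omega) (by omega) (by omega)
  have h75 := hne (k + 7) (k + 5) (by omega) (by omega) (by omega)
  have h86 := hne (k + 8) (k + 6) (by omega) (by omega) (by omega)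
  obtain ⟨hx4, hy4⟩ := hX4
  obtain ⟨hx5, hy5⟩ := hX5
  have hE : ω (k + 6) 0 = 1 ∧ ω (k + 6) 1 = ω k 1 + 3 * τ := by
    clear s6 s7 h75 h86 hX8 hX7
    rcases hτ with hτ | hτ <;> (subst hτ; constructor <;> omega)
  obtain ⟨hx6, hy6⟩ := hE
  clear s5 h64
  have hF : ω (k + 7) 0 = 2 ∧ ω (k + 7) 1 = ω k 1 + 3 * τ := by
    clear s7 h86 hX8
    rcases hτ with hτ | hτ <;> (subst hτ; constructor <;> omega)
  obtain ⟨hx7, hy7⟩ := hF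
  clear s6 h75 hX7
  rcases hτ with hτ | hτ <;> (subst hτ; omega)

/-- Nine-fibre, dead branch S2: `(1,Y+τ)(2,Y+τ)(3,Y+τ)`: then `(4,Y+τ)` cannot return in time and `(3,Y)(2,Y)(2,Y−τ)` ends facing
`(1,Y−τ) = ω_{k−2}` and `(1,Y) = ω_{k+1}`. [cite: EntingJensen2009, §7.4.2, Fig. 7.10] -/
theorem fibA_nine_dead_S2 {k : ℕ} (hk : 3 ≤ k) (hω : ω ∈ fibA (k + 6) k) {τ : ℤ} (hτ : τ = 1 ∨ τ = -1)
    (hpar : (ω k 1 - τ) % 2 = 0 ↔ τ = 1) (hX1 : ω (k + 1) 0 = 1 ∧ ω (k + 1) 1 = ω k 1) (hQ : ω (k - 2) 0 = 1 ∧ ω (k - 2) 1 = ω k 1 - τ)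
    (hX3 : ω (k + 3) 0 = 2 ∧ ω (k + 3) 1 = ω k 1 + τ) (hX4 : ω (k + 4) 0 = 3 ∧ ω (k + 4) 1 = ω k 1 + τ) : False := by
  obtain ⟨hωh, hend, -, hk0, hoff⟩ := fibA_anatomy hω
  rw [show k + 6 + 3 = k + 9 by omega] at hωh hend
  obtain ⟨hωs, hH⟩ := mem_hp.1 hωh
  obtain ⟨-, -, hbw, hinj⟩ := mem_saws_iff.1 hωs
  have hne : ∀ a b : ℕ, a ≤ k + 9 → b ≤ k + 9 → a ≠ b → ¬ (ω a 0 = ω b 0 ∧ ω a 1 = ω b 1) := by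
    intro a b ha hb hab h
    have := hinj (show a ∈ {i | i ≤ k + 9} by simp only [Set.mem_setOf_eq]; exact ha)
      (show b ∈ {i | i ≤ k + 9} by simp only [Set.mem_setOf_eq]; exact hb) ((site_two_eq_iff _ _).2 h)
    exact hab this
  have h3 := hoff (k + 3) (by omega) (by omega)
  have h4 := hoff (k + 4) (by omega) (by omega)
  have h5 := hoff (k + 5) (by omega) (by omega)
  have h6 := hoff (k + 6) (by omega) (by omega)
  have h7 := hoff (k + 7) (by omega) (by omega)
  have h8 := hoff (k + 8) (by omega) (by omega)
  have hX8n := hH (k + 8) (by omega)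
  have hX7n := hH (k + 7) (by omega)
  have hX6n := hH (k + 6) (by omega)
  have hX5n := hH (k + 5) (by omega)
  have s2 := step_cases (hbw (k + 2) (by omega))
  rw [show k + 2 + 1 = k + 3 by omega] at s2
  have s3 := step_cases (hbw (k + 3) (by omega))
  rw [show k + 3 + 1 = k + 4 by omega] at s3
  have s4 := step_cases (hbw (k + 4) (by omega))
  rw [show k + 4 + 1 = k + 5 by omega] at s4
  have s5 := step_cases (hbw (k + 5) (by omega))
  rw [show k + 5 + 1 = k + 6 by omega] at s5
  have s6 := step_cases (hbw (k + 6) (by omega))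
  rw [show k + 6 + 1 = k + 7 by omega] at s6
  have s7 := step_cases (hbw (k + 7) (by omega))
  rw [show k + 7 + 1 = k + 8 by omega] at s7
  have s8 := step_cases (hbw (k + 8) (by omega))
  rw [show k + 8 + 1 = k + 9 by omega] at s8
  -- `X_{k+8} = 1`, `X_{k+7} ∈ {1, 2}`
  have hX8 : ω (k + 8) 0 = 1 := by clear s2 s3 s4 s5 s6 s7; omega
  have hX7 : ω (k + 7) 0 = 1 ∨ ω (k + 7) 0 = 2 := by clear s2 s3 s4 s5 s6 s8; omega
  clear s2 s3 s8
  have h53 := hne (k + 5) (k + 3) (by omega) (by omega) (by omega)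
  have h64 := hne (k + 6) (k + 4) (by omega) (by omega) (by omega)
  have h71 := hne (k + 7) (k + 1) (by omega) (by omega) (by omega)
  have h8m2 := hne (k + 8) (k - 2) (by omega) (by omega) (by omega)
  have h82 := hne (k + 8) (k + 2) (by omega) (by omega) (by omega)
  obtain ⟨hx1, hy1⟩ := hX1
  obtain ⟨hq0, hq1⟩ := hQ
  obtain ⟨hx3, hy3⟩ := hX3
  obtain ⟨hx4, hy4⟩ := hX4
  have h75 := hne (k + 7) (k + 5) (by omega) (by omega) (by omega)
  have hD : (ω (k + 5) 0 = 4 ∧ ω (k + 5) 1 = ω k 1 + τ) ∨ (ω (k + 5) 0 = 3 ∧ ω (k + 5) 1 = ω k 1) := by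
    clear s5 s6 s7 h64 h71 h75 h8m2 h82 hX8 hX7
    rcases hτ with hτ | hτ <;> (subst hτ; omega)
  clear s4 h53
  rcases hD with ⟨hx5, hy5⟩ | ⟨hx5, hy5⟩
  · -- from `(4,Y+τ)`: `(3,Y+τ) = ω (k+4)` is used, so `X_{k+6} ∈ {4,5}` and `X_{k+7} ∉ {1,2}`
    have hE : ω (k + 6) 0 = 5 ∨ ω (k + 6) 0 = 4 := by
      clear s6 s7 h71 h75 h8m2 h82 hX8 hX7 hpar hq1; omega
    clear s5 h64
    clear s7 h71 h75 h8m2 h82 hX8 hpar hq1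
    omega
  · have hE : (ω (k + 6) 0 = 2 ∧ ω (k + 6) 1 = ω k 1) ∨ ω (k + 6) 0 = 4 := by
      clear s6 s7 h71 h75 h8m2 h82 hX8 hX7 hq1
      rcases hτ with hτ | hτ <;> (subst hτ; omega)
    clear s5 h64
    rcases hE with ⟨hx6, hy6⟩ | hx6
    · have hF : ω (k + 7) 0 = 2 ∧ ω (k + 7) 1 = ω k 1 - τ := by
        clear s7 h8m2 h82 hX8
        rcases hτ with hτ | hτ <;> (subst hτ; constructor <;> omega)
      obtain ⟨hx7, hy7⟩ := hF
      clear s6 h71 h75 hX7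
      rcases hτ with hτ | hτ <;> (subst hτ; omega)
    · clear s7 h71 h75 h8m2 h82 hX8 hpar hq1
      omega

/-- Nine-fibre, branch S1b (the shape of `Defect.nineB`): `(1,Y+τ)(2,Y+τ)(2,Y+2τ)(3,Y+2τ)` forces `(3,Y+3τ)(2,Y+3τ)(1,Y+3τ)(0,Y+3τ)`.
[cite: EntingJensen2009, §7.4.2, Fig. 7.10; Beaton2014RotatedHoneycomb, §3.1 (arXiv v3 p. 12)] -/
theorem fibA_nine_S1b {k : ℕ} (hω : ω ∈ fibA (k + 6) k) {τ : ℤ} (hτ : τ = 1 ∨ τ = -1)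
    (hpar : (ω k 1 - τ) % 2 = 0 ↔ τ = 1) (hX4 : ω (k + 4) 0 = 2 ∧ ω (k + 4) 1 = ω k 1 + 2 * τ)
    (hX5 : ω (k + 5) 0 = 3 ∧ ω (k + 5) 1 = ω k 1 + 2 * τ) :
    (ω (k + 6) 0 = 3 ∧ ω (k + 6) 1 = ω k 1 + 3 * τ) ∧ (ω (k + 7) 0 = 2 ∧ ω (k + 7) 1 = ω k 1 + 3 * τ) ∧
      (ω (k + 8) 0 = 1 ∧ ω (k + 8) 1 = ω k 1 + 3 * τ) ∧ (ω (k + 9) 0 = 0 ∧ ω (k + 9) 1 = ω k 1 + 3 * τ) := by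
  obtain ⟨hωh, hend, -, hk0, hoff⟩ := fibA_anatomy hω
  rw [show k + 6 + 3 = k + 9 by omega] at hωh hend
  obtain ⟨hωs, hH⟩ := mem_hp.1 hωh
  obtain ⟨-, -, hbw, hinj⟩ := mem_saws_iff.1 hωs
  have hne : ∀ a b : ℕ, a ≤ k + 9 → b ≤ k + 9 → a ≠ b → ¬ (ω a 0 = ω b 0 ∧ ω a 1 = ω b 1) := by
    intro a b ha hb hab h
    have := hinj (show a ∈ {i | i ≤ k + 9} by simp only [Set.mem_setOf_eq]; exact ha)
      (show b ∈ {i | i ≤ k + 9} by simp only [Set.mem_setOf_eq]; exact hb) ((site_two_eq_iff _ _).2 h)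
    exact hab this
  have h3 := hoff (k + 3) (by omega) (by omega)
  have h4 := hoff (k + 4) (by omega) (by omega)
  have h5 := hoff (k + 5) (by omega) (by omega)
  have h6 := hoff (k + 6) (by omega) (by omega)
  have h7 := hoff (k + 7) (by omega) (by omega)
  have h8 := hoff (k + 8) (by omega) (by omega)
  have hX8n := hH (k + 8) (by omega)
  have hX7n := hH (k + 7) (by omega)
  have hX6n := hH (k + 6) (by omega)
  have hX5n := hH (k + 5) (by omega)
  have s2 := step_cases (hbw (k + 2) (by omega))
  rw [show k + 2 + 1 = k + 3 by omega] at s2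
  have s3 := step_cases (hbw (k + 3) (by omega))
  rw [show k + 3 + 1 = k + 4 by omega] at s3
  have s4 := step_cases (hbw (k + 4) (by omega))
  rw [show k + 4 + 1 = k + 5 by omega] at s4
  have s5 := step_cases (hbw (k + 5) (by omega))
  rw [show k + 5 + 1 = k + 6 by omega] at s5
  have s6 := step_cases (hbw (k + 6) (by omega))
  rw [show k + 6 + 1 = k + 7 by omega] at s6
  have s7 := step_cases (hbw (k + 7) (by omega))
  rw [show k + 7 + 1 = k + 8 by omega] at s7
  have s8 := step_cases (hbw (k + 8) (by omega))
  rw [show k + 8 + 1 = k + 9 by omega] at s8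
  -- `X_{k+8} = 1`, `X_{k+7} ∈ {1, 2}`
  have hX8 : ω (k + 8) 0 = 1 := by clear s2 s3 s4 s5 s6 s7; omega
  have hX7 : ω (k + 7) 0 = 1 ∨ ω (k + 7) 0 = 2 := by clear s2 s3 s4 s5 s6 s8; omega
  clear s2 s3 s4
  have h64 := hne (k + 6) (k + 4) (by omega) (by omega) (by omega)
  have h75 := hne (k + 7) (k + 5) (by omega) (by omega) (by omega)
  have h86 := hne (k + 8) (k + 6) (by omega) (by omega) (by omega)
  obtain ⟨hx4, hy4⟩ := hX4
  obtain ⟨hx5, hy5⟩ := hX5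
  have hE : ω (k + 6) 0 = 4 ∨ (ω (k + 6) 0 = 3 ∧ ω (k + 6) 1 = ω k 1 + 3 * τ) := by
    clear s6 s7 s8 h75 h86 hX8 hX7
    rcases hτ with hτ | hτ <;> (subst hτ; omega)
  clear s5 h64
  have hnot : ω (k + 6) 0 ≠ 4 := by
    intro hx6; clear s7 s8 h75 h86 hX8 hpar hE; omega
  obtain ⟨hx6, hy6⟩ := hE.resolve_left hnot
  clear hE hnot
  have hF : ω (k + 7) 0 = 2 ∧ ω (k + 7) 1 = ω k 1 + 3 * τ := by
    clear s7 s8 h86 hX8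
    rcases hτ with hτ | hτ <;> (subst hτ; constructor <;> omega)
  obtain ⟨hx7, hy7⟩ := hF
  clear s6 h75 hX7
  have hG : ω (k + 8) 1 = ω k 1 + 3 * τ := by
    clear s8 h86
    rcases hτ with hτ | hτ <;> (subst hτ; omega)
  clear s7 h86
  refine ⟨⟨hx6, hy6⟩, ⟨hx7, hy7⟩, ⟨hX8, hG⟩, hend, ?_⟩
  omega

set_option maxHeartbeats 400000 in
/-- Nine-fibre, branch W1 in the context `ω_{k−3} = (1,Y−2τ)`: `(2,Y)(2,Y−τ)` is forced DOWN along
`(3,Y−τ)(3,Y−2τ)(2,Y−2τ)(2,Y−3τ)(1,Y−3τ)(0,Y−3τ)`. [cite: EntingJensen2009, §7.4.2, Fig. 7.10] -/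
theorem fibA_nine_W1_chain {k : ℕ} (hk : 3 ≤ k) (hω : ω ∈ fibA (k + 6) k) {τ : ℤ} (hτ : τ = 1 ∨ τ = -1)
    (hpar : (ω k 1 - τ) % 2 = 0 ↔ τ = 1) (hQ : ω (k - 2) 0 = 1 ∧ ω (k - 2) 1 = ω k 1 - τ)
    (hc : ω (k - 3) 0 = 1 ∧ ω (k - 3) 1 = ω k 1 - 2 * τ)
    (hX2 : ω (k + 2) 0 = 2 ∧ ω (k + 2) 1 = ω k 1) (hX3 : ω (k + 3) 0 = 2 ∧ ω (k + 3) 1 = ω k 1 - τ) :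
    (ω (k + 4) 0 = 3 ∧ ω (k + 4) 1 = ω k 1 - τ) ∧ (ω (k + 5) 0 = 3 ∧ ω (k + 5) 1 = ω k 1 - 2 * τ) ∧
      (ω (k + 6) 0 = 2 ∧ ω (k + 6) 1 = ω k 1 - 2 * τ) ∧ (ω (k + 7) 0 = 2 ∧ ω (k + 7) 1 = ω k 1 - 3 * τ) ∧
      (ω (k + 8) 0 = 1 ∧ ω (k + 8) 1 = ω k 1 - 3 * τ) ∧ (ω (k + 9) 0 = 0 ∧ ω (k + 9) 1 = ω k 1 - 3 * τ) := by
  obtain ⟨hωh, hend, -, hk0, hoff⟩ := fibA_anatomy hω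
  rw [show k + 6 + 3 = k + 9 by omega] at hωh hend
  obtain ⟨hωs, hH⟩ := mem_hp.1 hωh
  obtain ⟨-, -, hbw, hinj⟩ := mem_saws_iff.1 hωs
  have hne : ∀ a b : ℕ, a ≤ k + 9 → b ≤ k + 9 → a ≠ b → ¬ (ω a 0 = ω b 0 ∧ ω a 1 = ω b 1) := by
    intro a b ha hb hab h
    have := hinj (show a ∈ {i | i ≤ k + 9} by simp only [Set.mem_setOf_eq]; exact ha)
      (show b ∈ {i | i ≤ k + 9} by simp only [Set.mem_setOf_eq]; exact hb) ((site_two_eq_iff _ _).2 h)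
    exact hab this
  have h4 := hoff (k + 4) (by omega) (by omega)
  have h5 := hoff (k + 5) (by omega) (by omega)
  have h6 := hoff (k + 6) (by omega) (by omega)
  have h7 := hoff (k + 7) (by omega) (by omega)
  have h8 := hoff (k + 8) (by omega) (by omega)
  have hX8n := hH (k + 8) (by omega)
  have hX7n := hH (k + 7) (by omega)
  have s3 := step_cases (hbw (k + 3) (by omega))
  rw [show k + 3 + 1 = k + 4 by omega] at s3
  have s4 := step_cases (hbw (k + 4) (by omega))
  rw [show k + 4 + 1 = k + 5 by omega] at s4
  have s5 := step_cases (hbw (k + 5) (by omega))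
  rw [show k + 5 + 1 = k + 6 by omega] at s5
  have s6 := step_cases (hbw (k + 6) (by omega))
  rw [show k + 6 + 1 = k + 7 by omega] at s6
  have s7 := step_cases (hbw (k + 7) (by omega))
  rw [show k + 7 + 1 = k + 8 by omega] at s7
  have s8 := step_cases (hbw (k + 8) (by omega))
  rw [show k + 8 + 1 = k + 9 by omega] at s8
  have hX8 : ω (k + 8) 0 = 1 := by clear * - s8 h8 hX8n hend; omega
  have hX7 : ω (k + 7) 0 = 1 ∨ ω (k + 7) 0 = 2 := by clear * - s7 h7 hX7n hX8; omega
  have h4m2 := hne (k + 4) (k - 2) (by omega) (by omega) (by omega)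
  have h42 := hne (k + 4) (k + 2) (by omega) (by omega) (by omega)
  have h53 := hne (k + 5) (k + 3) (by omega) (by omega) (by omega)
  have h64 := hne (k + 6) (k + 4) (by omega) (by omega) (by omega)
  have h7m3 := hne (k + 7) (k - 3) (by omega) (by omega) (by omega)
  have h75 := hne (k + 7) (k + 5) (by omega) (by omega) (by omega)
  obtain ⟨hx2, hy2⟩ := hX2
  obtain ⟨hx3, hy3⟩ := hX3
  obtain ⟨hq0, hq1⟩ := hQ
  obtain ⟨hc0, hc1⟩ := hc
  have hC : ω (k + 4) 0 = 3 ∧ ω (k + 4) 1 = ω k 1 - τ := by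
    clear * - s3 hx3 hy3 hx2 hy2 hq0 hq1 h42 h4m2 h4 hpar hτ
    rcases hτ with hτ | hτ <;> (subst hτ; constructor <;> omega)
  obtain ⟨hx4, hy4⟩ := hC
  have hD : (ω (k + 5) 0 = 4 ∧ ω (k + 5) 1 = ω k 1 - τ) ∨ (ω (k + 5) 0 = 3 ∧ ω (k + 5) 1 = ω k 1 - 2 * τ) := by
    clear * - s4 hx4 hy4 hx3 hy3 h53 h5 hpar hτ
    rcases hτ with hτ | hτ <;> (subst hτ; omega)
  have hnot5 : ¬ (ω (k + 5) 0 = 4 ∧ ω (k + 5) 1 = ω k 1 - τ) := by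
    rintro ⟨hx5, hy5⟩
    have : ω (k + 6) 0 = 5 ∨ ω (k + 6) 0 = 4 := by clear * - s5 hx5 hy5 hx4 hy4 h64 h6; omega
    clear * - this s6 hX7
    omega
  obtain ⟨hx5, hy5⟩ := hD.resolve_left hnot5
  have hE : ω (k + 6) 0 = 4 ∨ (ω (k + 6) 0 = 2 ∧ ω (k + 6) 1 = ω k 1 - 2 * τ) := by
    clear * - s5 hx5 hy5 hx4 hy4 h64 h6 hpar hτ
    rcases hτ with hτ | hτ <;> (subst hτ; omega)
  have hnot6 : ω (k + 6) 0 ≠ 4 := by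
    intro hx6; clear * - s6 hx6 hX7; omega
  obtain ⟨hx6, hy6⟩ := hE.resolve_left hnot6
  have hF : ω (k + 7) 0 = 2 ∧ ω (k + 7) 1 = ω k 1 - 3 * τ := by
    clear * - s6 hx6 hy6 hx5 hy5 h75 hc0 hc1 h7m3 hX7 hpar hτ
    rcases hτ with hτ | hτ <;> (subst hτ; constructor <;> omega)
  obtain ⟨hx7, hy7⟩ := hF
  have hG : ω (k + 8) 1 = ω k 1 - 3 * τ := by
    clear * - s7 hx7 hy7 hX8 hτ
    rcases hτ with hτ | hτ <;> (subst hτ; omega)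
  have hI : ω (k + 9) 1 = ω k 1 - 3 * τ := by clear * - s8 hX8 hG hend; omega
  exact ⟨⟨hx4, hy4⟩, ⟨hx5, hy5⟩, ⟨hx6, hy6⟩, ⟨hx7, hy7⟩, ⟨hX8, hG⟩, hend, hI⟩

/-- Nine-fibre, dead branch W1 (needs two-step aliveness): `(2,Y)(2,Y−τ)` meets `ω_{k−3} = (2,Y−τ)`, or — when `ω_{k−3} = (1,Y−2τ)` — runs
DOWN to `(0,Y−3τ)`, whose only other neighbour `(0,Y−2τ)` is boxed by `ω_{k−3}` and the end: not two-step alive.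
[cite: EntingJensen2009, §7.4.2, Fig. 7.10; HammersleyTorrieWhittington1982, §2] -/
theorem fibA_nine_dead_W1 {k : ℕ} (hk : 3 ≤ k) (hω : ω ∈ fibA (k + 6) k) (hal : Alive2 (k + 9) ω) {τ : ℤ} (hτ : τ = 1 ∨ τ = -1)
    (hpar : (ω k 1 - τ) % 2 = 0 ↔ τ = 1) (hQ : ω (k - 2) 0 = 1 ∧ ω (k - 2) 1 = ω k 1 - τ)
    (hctx : (ω (k - 3) 0 = 2 ∧ ω (k - 3) 1 = ω k 1 - τ) ∨ (ω (k - 3) 0 = 1 ∧ ω (k - 3) 1 = ω k 1 - 2 * τ))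
    (hX2 : ω (k + 2) 0 = 2 ∧ ω (k + 2) 1 = ω k 1) (hX3 : ω (k + 3) 0 = 2 ∧ ω (k + 3) 1 = ω k 1 - τ) : False := by
  obtain ⟨hωh, -, -, -, -⟩ := fibA_anatomy hω
  rw [show k + 6 + 3 = k + 9 by omega] at hωh
  obtain ⟨hωs, -⟩ := mem_hp.1 hωh
  obtain ⟨-, -, -, hinj⟩ := mem_saws_iff.1 hωs
  have hne : ∀ a b : ℕ, a ≤ k + 9 → b ≤ k + 9 → a ≠ b → ¬ (ω a 0 = ω b 0 ∧ ω a 1 = ω b 1) := by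
    intro a b ha hb hab h
    have := hinj (show a ∈ {i | i ≤ k + 9} by simp only [Set.mem_setOf_eq]; exact ha)
      (show b ∈ {i | i ≤ k + 9} by simp only [Set.mem_setOf_eq]; exact hb) ((site_two_eq_iff _ _).2 h)
    exact hab this
  rcases hctx with ⟨hc0, hc1⟩ | hc
  · exact hne (k + 3) (k - 3) (by omega) (by omega) (by omega) ⟨by omega, by omega⟩
  obtain ⟨-, -, -, -, ⟨hX8, hY8⟩, ⟨hX9, hY9⟩⟩ := fibA_nine_W1_chain hk hω hτ hpar hQ hc hX2 hX3
  obtain ⟨hc0, hc1⟩ := hc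
  obtain ⟨z₁, z₂, hz1, hz2, hz1n, hz2n, hfresh⟩ := hal
  rw [brickWallGraph_adj_coord] at hz1 hz2
  obtain ⟨f8a, -⟩ := hfresh (k + 8) (by omega)
  obtain ⟨-, f9b⟩ := hfresh (k + 9) le_rfl
  obtain ⟨-, fm3b⟩ := hfresh (k - 3) (by omega)
  have a8 : ¬ (ω (k + 8) 0 = z₁ 0 ∧ ω (k + 8) 1 = z₁ 1) := fun h => f8a ((site_two_eq_iff _ _).2 h)
  have b9 : ¬ (ω (k + 9) 0 = z₂ 0 ∧ ω (k + 9) 1 = z₂ 1) := fun h => f9b ((site_two_eq_iff _ _).2 h)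
  have bm3 : ¬ (ω (k - 3) 0 = z₂ 0 ∧ ω (k - 3) 1 = z₂ 1) := fun h => fm3b ((site_two_eq_iff _ _).2 h)
  have hz1c : z₁ 0 = 0 ∧ z₁ 1 = ω k 1 - 2 * τ := by
    clear hz2 b9 bm3
    rcases hτ with hτ | hτ <;> (subst hτ; constructor <;> omega)
  obtain ⟨hz1x, hz1y⟩ := hz1c
  clear hz1 a8
  rcases hτ with hτ | hτ <;> (subst hτ; omega)

/-- Nine-fibre, dead branch W2a: `(2,Y)(3,Y)(4,Y)` is forced along `(4,Y−τ)(3,Y−τ)(2,Y−τ)` and then faces `(1,Y−τ) = ω_{k−2}`.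
[cite: EntingJensen2009, §7.4.2, Fig. 7.10] -/
theorem fibA_nine_dead_W2a {k : ℕ} (hk : 3 ≤ k) (hω : ω ∈ fibA (k + 6) k) {τ : ℤ} (hτ : τ = 1 ∨ τ = -1)
    (hpar : (ω k 1 - τ) % 2 = 0 ↔ τ = 1) (hQ : ω (k - 2) 0 = 1 ∧ ω (k - 2) 1 = ω k 1 - τ)
    (hX3 : ω (k + 3) 0 = 3 ∧ ω (k + 3) 1 = ω k 1) (hX4 : ω (k + 4) 0 = 4 ∧ ω (k + 4) 1 = ω k 1) : False := by
  obtain ⟨hωh, hend, -, hk0, hoff⟩ := fibA_anatomy hω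
  rw [show k + 6 + 3 = k + 9 by omega] at hωh hend
  obtain ⟨hωs, hH⟩ := mem_hp.1 hωh
  obtain ⟨-, -, hbw, hinj⟩ := mem_saws_iff.1 hωs
  have hne : ∀ a b : ℕ, a ≤ k + 9 → b ≤ k + 9 → a ≠ b → ¬ (ω a 0 = ω b 0 ∧ ω a 1 = ω b 1) := by
    intro a b ha hb hab h
    have := hinj (show a ∈ {i | i ≤ k + 9} by simp only [Set.mem_setOf_eq]; exact ha)
      (show b ∈ {i | i ≤ k + 9} by simp only [Set.mem_setOf_eq]; exact hb) ((site_two_eq_iff _ _).2 h)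
    exact hab this
  have h3 := hoff (k + 3) (by omega) (by omega)
  have h4 := hoff (k + 4) (by omega) (by omega)
  have h5 := hoff (k + 5) (by omega) (by omega)
  have h6 := hoff (k + 6) (by omega) (by omega)
  have h7 := hoff (k + 7) (by omega) (by omega)
  have h8 := hoff (k + 8) (by omega) (by omega)
  have hX8n := hH (k + 8) (by omega)
  have hX7n := hH (k + 7) (by omega)
  have hX6n := hH (k + 6) (by omega)
  have hX5n := hH (k + 5) (by omega)
  have s2 := step_cases (hbw (k + 2) (by omega))
  rw [show k + 2 + 1 = k + 3 by omega] at s2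
  have s3 := step_cases (hbw (k + 3) (by omega))
  rw [show k + 3 + 1 = k + 4 by omega] at s3
  have s4 := step_cases (hbw (k + 4) (by omega))
  rw [show k + 4 + 1 = k + 5 by omega] at s4
  have s5 := step_cases (hbw (k + 5) (by omega))
  rw [show k + 5 + 1 = k + 6 by omega] at s5
  have s6 := step_cases (hbw (k + 6) (by omega))
  rw [show k + 6 + 1 = k + 7 by omega] at s6
  have s7 := step_cases (hbw (k + 7) (by omega))
  rw [show k + 7 + 1 = k + 8 by omega] at s7
  have s8 := step_cases (hbw (k + 8) (by omega))
  rw [show k + 8 + 1 = k + 9 by omega] at s8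
  -- `X_{k+8} = 1`, `X_{k+7} ∈ {1, 2}`
  have hX8 : ω (k + 8) 0 = 1 := by clear s2 s3 s4 s5 s6 s7; omega
  have hX7 : ω (k + 7) 0 = 1 ∨ ω (k + 7) 0 = 2 := by clear s2 s3 s4 s5 s6 s8; omega
  clear s2 s3
  have h53 := hne (k + 5) (k + 3) (by omega) (by omega) (by omega)
  have h64 := hne (k + 6) (k + 4) (by omega) (by omega) (by omega)
  have h75 := hne (k + 7) (k + 5) (by omega) (by omega) (by omega)
  have h8m2 := hne (k + 8) (k - 2) (by omega) (by omega) (by omega)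
  obtain ⟨hx3, hy3⟩ := hX3
  obtain ⟨hx4, hy4⟩ := hX4
  obtain ⟨hq0, hq1⟩ := hQ
  have hD : ω (k + 5) 0 = 5 ∨ (ω (k + 5) 0 = 4 ∧ ω (k + 5) 1 = ω k 1 - τ) := by
    clear s5 s6 s7 s8 h64 h75 h8m2 hX8 hX7
    rcases hτ with hτ | hτ <;> (subst hτ; omega)
  clear s4 h53
  have hnot5 : ω (k + 5) 0 ≠ 5 := by
    intro hx5
    have : ω (k + 6) 0 = 6 ∨ ω (k + 6) 0 = 4 ∨ ω (k + 6) 0 = 5 := by clear s6 s7 s8 h75 h8m2 hX8 hX7 hpar hq1 hD; omega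
    clear s5 h64 hD s7 s8 h75 h8m2 hX8 hpar hq1
    omega
  obtain ⟨hx5, hy5⟩ := hD.resolve_left hnot5
  clear hD hnot5
  have hE : ω (k + 6) 0 = 5 ∨ (ω (k + 6) 0 = 3 ∧ ω (k + 6) 1 = ω k 1 - τ) := by
    clear s6 s7 s8 h75 h8m2 hX8 hX7
    rcases hτ with hτ | hτ <;> (subst hτ; omega)
  clear s5 h64
  have hnot6 : ω (k + 6) 0 ≠ 5 := by
    intro hx6; clear s7 s8 h75 h8m2 hX8 hpar hq1 hE; omega
  obtain ⟨hx6, hy6⟩ := hE.resolve_left hnot6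
  clear hE hnot6
  have hF : ω (k + 7) 0 = 2 ∧ ω (k + 7) 1 = ω k 1 - τ := by
    clear s7 s8 h8m2 hX8
    rcases hτ with hτ | hτ <;> (subst hτ; constructor <;> omega)
  obtain ⟨hx7, hy7⟩ := hF
  clear s6 h75 hX7
  rcases hτ with hτ | hτ <;> (subst hτ; omega)

set_option maxHeartbeats 400000 in
/-- Nine-fibre, branch W2b (the shape of `Defect.nineA`): `(2,Y)(3,Y)(3,Y+τ)` forces `(2,Y+τ)(2,Y+2τ)(1,Y+2τ)(1,Y+3τ)(0,Y+3τ)`.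
[cite: EntingJensen2009, §7.4.2, Fig. 7.10; Beaton2014RotatedHoneycomb, §3.1 (arXiv v3 p. 12)] -/
theorem fibA_nine_W2b {k : ℕ} (hω : ω ∈ fibA (k + 6) k) {τ : ℤ} (hτ : τ = 1 ∨ τ = -1)
    (hpar : (ω k 1 - τ) % 2 = 0 ↔ τ = 1) (hX1 : ω (k + 1) 0 = 1 ∧ ω (k + 1) 1 = ω k 1)
    (hX3 : ω (k + 3) 0 = 3 ∧ ω (k + 3) 1 = ω k 1) (hX4 : ω (k + 4) 0 = 3 ∧ ω (k + 4) 1 = ω k 1 + τ) :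
    (ω (k + 5) 0 = 2 ∧ ω (k + 5) 1 = ω k 1 + τ) ∧ (ω (k + 6) 0 = 2 ∧ ω (k + 6) 1 = ω k 1 + 2 * τ) ∧
      (ω (k + 7) 0 = 1 ∧ ω (k + 7) 1 = ω k 1 + 2 * τ) ∧ (ω (k + 8) 0 = 1 ∧ ω (k + 8) 1 = ω k 1 + 3 * τ) ∧
      (ω (k + 9) 0 = 0 ∧ ω (k + 9) 1 = ω k 1 + 3 * τ) := by
  obtain ⟨hωh, hend, -, hk0, hoff⟩ := fibA_anatomy hω
  rw [show k + 6 + 3 = k + 9 by omega] at hωh hend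
  obtain ⟨hωs, hH⟩ := mem_hp.1 hωh
  obtain ⟨-, -, hbw, hinj⟩ := mem_saws_iff.1 hωs
  have hne : ∀ a b : ℕ, a ≤ k + 9 → b ≤ k + 9 → a ≠ b → ¬ (ω a 0 = ω b 0 ∧ ω a 1 = ω b 1) := by
    intro a b ha hb hab h
    have := hinj (show a ∈ {i | i ≤ k + 9} by simp only [Set.mem_setOf_eq]; exact ha)
      (show b ∈ {i | i ≤ k + 9} by simp only [Set.mem_setOf_eq]; exact hb) ((site_two_eq_iff _ _).2 h)
    exact hab this
  have h3 := hoff (k + 3) (by omega) (by omega)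
  have h4 := hoff (k + 4) (by omega) (by omega)
  have h5 := hoff (k + 5) (by omega) (by omega)
  have h6 := hoff (k + 6) (by omega) (by omega)
  have h7 := hoff (k + 7) (by omega) (by omega)
  have h8 := hoff (k + 8) (by omega) (by omega)
  have hX8n := hH (k + 8) (by omega)
  have hX7n := hH (k + 7) (by omega)
  have hX6n := hH (k + 6) (by omega)
  have hX5n := hH (k + 5) (by omega)
  have s2 := step_cases (hbw (k + 2) (by omega))
  rw [show k + 2 + 1 = k + 3 by omega] at s2
  have s3 := step_cases (hbw (k + 3) (by omega))
  rw [show k + 3 + 1 = k + 4 by omega] at s3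
  have s4 := step_cases (hbw (k + 4) (by omega))
  rw [show k + 4 + 1 = k + 5 by omega] at s4
  have s5 := step_cases (hbw (k + 5) (by omega))
  rw [show k + 5 + 1 = k + 6 by omega] at s5
  have s6 := step_cases (hbw (k + 6) (by omega))
  rw [show k + 6 + 1 = k + 7 by omega] at s6
  have s7 := step_cases (hbw (k + 7) (by omega))
  rw [show k + 7 + 1 = k + 8 by omega] at s7
  have s8 := step_cases (hbw (k + 8) (by omega))
  rw [show k + 8 + 1 = k + 9 by omega] at s8
  -- `X_{k+8} = 1`, `X_{k+7} ∈ {1, 2}`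
  have hX8 : ω (k + 8) 0 = 1 := by clear s2 s3 s4 s5 s6 s7; omega
  have hX7 : ω (k + 7) 0 = 1 ∨ ω (k + 7) 0 = 2 := by clear s2 s3 s4 s5 s6 s8; omega
  clear s2 s3
  have h53 := hne (k + 5) (k + 3) (by omega) (by omega) (by omega)
  have h64 := hne (k + 6) (k + 4) (by omega) (by omega) (by omega)
  have h71 := hne (k + 7) (k + 1) (by omega) (by omega) (by omega)
  have h75 := hne (k + 7) (k + 5) (by omega) (by omega) (by omega)
  have h86 := hne (k + 8) (k + 6) (by omega) (by omega) (by omega)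
  obtain ⟨hx1, hy1⟩ := hX1
  obtain ⟨hx3, hy3⟩ := hX3
  obtain ⟨hx4, hy4⟩ := hX4
  have hD : (ω (k + 5) 0 = 4 ∧ ω (k + 5) 1 = ω k 1 + τ) ∨ (ω (k + 5) 0 = 2 ∧ ω (k + 5) 1 = ω k 1 + τ) := by
    clear s5 s6 s7 s8 h64 h71 h75 h86 hX8 hX7
    rcases hτ with hτ | hτ <;> (subst hτ; omega)
  clear s4 h53
  have hnot5 : ¬ (ω (k + 5) 0 = 4 ∧ ω (k + 5) 1 = ω k 1 + τ) := by
    rintro ⟨hx5, hy5⟩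
    have : ω (k + 6) 0 = 5 ∨ ω (k + 6) 0 = 4 := by clear s6 s7 s8 h71 h75 h86 hX8 hX7 hpar hD; omega
    clear s5 h64 hD s7 s8 h71 h75 h86 hX8 hpar
    omega
  obtain ⟨hx5, hy5⟩ := hD.resolve_left hnot5
  clear hD hnot5
  have hE : (ω (k + 6) 0 = 1 ∧ ω (k + 6) 1 = ω k 1 + τ) ∨ (ω (k + 6) 0 = 2 ∧ ω (k + 6) 1 = ω k 1 + 2 * τ) := by
    clear s6 s7 s8 h71 h75 h86 hX8 hX7
    rcases hτ with hτ | hτ <;> (subst hτ; omega)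
  clear s5 h64
  have hnot6 : ¬ (ω (k + 6) 0 = 1 ∧ ω (k + 6) 1 = ω k 1 + τ) := by
    rintro ⟨hx6, hy6⟩
    clear hE s7 s8 h86 hX8
    rcases hτ with hτ | hτ <;> (subst hτ; omega)
  obtain ⟨hx6, hy6⟩ := hE.resolve_left hnot6
  clear hE hnot6
  have hF : ω (k + 7) 0 = 1 ∧ ω (k + 7) 1 = ω k 1 + 2 * τ := by
    clear s7 s8 h86 hX8 h71
    rcases hτ with hτ | hτ <;> (subst hτ; constructor <;> omega)
  obtain ⟨hx7, hy7⟩ := hF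
  clear s6 h75 hX7 h71
  have hG : ω (k + 8) 1 = ω k 1 + 3 * τ := by
    clear s8
    rcases hτ with hτ | hτ <;> (subst hτ; omega)
  clear s7 h86
  refine ⟨⟨hx5, hy5⟩, ⟨hx6, hy6⟩, ⟨hx7, hy7⟩, ⟨hX8, hG⟩, hend, ?_⟩
  omega

set_option maxHeartbeats 400000 in
/-- **The nine-fibre under two-step aliveness: exactly two shapes** (`k ≥ 3`) — `Defect.nineB`'s excursion
`(1,Y)(1,Y+τ)(2,Y+τ)(2,Y+2τ)(3,Y+2τ)(3,Y+3τ)(2,Y+3τ)(1,Y+3τ)(0,Y+3τ)` (`X_{k+2} = 1`) or `Defect.nineA`'s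
`(1,Y)(2,Y)(3,Y)(3,Y+τ)(2,Y+τ)(2,Y+2τ)(1,Y+2τ)(1,Y+3τ)(0,Y+3τ)` (`X_{k+2} = 2`).
[cite: Beaton2014RotatedHoneycomb, §3.1 (arXiv v3 p. 12); EntingJensen2009, §7.4.2, Fig. 7.10] -/
theorem fibA_nine_coords {k : ℕ} (hk : 3 ≤ k) (hω : ω ∈ fibA (k + 6) k) (hal : Alive2 (k + 9) ω) :
    ∃ τ : ℤ, (τ = 1 ∨ τ = -1) ∧ ω (k - 1) 0 = 0 ∧ ω (k - 1) 1 = ω k 1 - τ ∧ (ω (k + 1) 0 = 1 ∧ ω (k + 1) 1 = ω k 1) ∧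
      ((ω (k + 2) 0 = 1 ∧ ω (k + 2) 1 = ω k 1 + τ ∧ ω (k + 3) 0 = 2 ∧ ω (k + 3) 1 = ω k 1 + τ ∧
          ω (k + 4) 0 = 2 ∧ ω (k + 4) 1 = ω k 1 + 2 * τ ∧ ω (k + 5) 0 = 3 ∧ ω (k + 5) 1 = ω k 1 + 2 * τ ∧
          ω (k + 6) 0 = 3 ∧ ω (k + 6) 1 = ω k 1 + 3 * τ ∧ ω (k + 7) 0 = 2 ∧ ω (k + 7) 1 = ω k 1 + 3 * τ ∧
          ω (k + 8) 0 = 1 ∧ ω (k + 8) 1 = ω k 1 + 3 * τ ∧ ω (k + 9) 0 = 0 ∧ ω (k + 9) 1 = ω k 1 + 3 * τ) ∨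
        (ω (k + 2) 0 = 2 ∧ ω (k + 2) 1 = ω k 1 ∧ ω (k + 3) 0 = 3 ∧ ω (k + 3) 1 = ω k 1 ∧
          ω (k + 4) 0 = 3 ∧ ω (k + 4) 1 = ω k 1 + τ ∧ ω (k + 5) 0 = 2 ∧ ω (k + 5) 1 = ω k 1 + τ ∧
          ω (k + 6) 0 = 2 ∧ ω (k + 6) 1 = ω k 1 + 2 * τ ∧ ω (k + 7) 0 = 1 ∧ ω (k + 7) 1 = ω k 1 + 2 * τ ∧
          ω (k + 8) 0 = 1 ∧ ω (k + 8) 1 = ω k 1 + 3 * τ ∧ ω (k + 9) 0 = 0 ∧ ω (k + 9) 1 = ω k 1 + 3 * τ)) := by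
  obtain ⟨τ, hτ, hX1, hY1, hP0, hPY, hQ0, hQY, hpar, hctx⟩ := launch_context₃ hk (by omega) hω
  obtain ⟨hωh, hend, -, hk0, hoff⟩ := fibA_anatomy hω
  rw [show k + 6 + 3 = k + 9 by omega] at hωh hend
  obtain ⟨hωs, hH⟩ := mem_hp.1 hωh
  obtain ⟨-, -, hbw, hinj⟩ := mem_saws_iff.1 hωs
  have hne : ∀ a b : ℕ, a ≤ k + 9 → b ≤ k + 9 → a ≠ b → ¬ (ω a 0 = ω b 0 ∧ ω a 1 = ω b 1) := by
    intro a b ha hb hab h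
    have := hinj (show a ∈ {i | i ≤ k + 9} by simp only [Set.mem_setOf_eq]; exact ha)
      (show b ∈ {i | i ≤ k + 9} by simp only [Set.mem_setOf_eq]; exact hb) ((site_two_eq_iff _ _).2 h)
    exact hab this
  have h2 := hoff (k + 2) (by omega) (by omega)
  have h3 := hoff (k + 3) (by omega) (by omega)
  have h4 := hoff (k + 4) (by omega) (by omega)
  have h5 := hoff (k + 5) (by omega) (by omega)
  have s1 := step_cases (hbw (k + 1) (by omega))
  rw [show k + 1 + 1 = k + 2 by omega] at s1
  have s2 := step_cases (hbw (k + 2) (by omega))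
  rw [show k + 2 + 1 = k + 3 by omega] at s2
  have s3 := step_cases (hbw (k + 3) (by omega))
  rw [show k + 3 + 1 = k + 4 by omega] at s3
  have s4 := step_cases (hbw (k + 4) (by omega))
  rw [show k + 4 + 1 = k + 5 by omega] at s4
  have h31 := hne (k + 3) (k + 1) (by omega) (by omega) (by omega)
  have h42 := hne (k + 4) (k + 2) (by omega) (by omega) (by omega)
  have h53 := hne (k + 5) (k + 3) (by omega) (by omega) (by omega)
  refine ⟨τ, hτ, hP0, hPY, ⟨hX1, hY1⟩, ?_⟩
  have hA : (ω (k + 2) 0 = 2 ∧ ω (k + 2) 1 = ω k 1) ∨ (ω (k + 2) 0 = 1 ∧ ω (k + 2) 1 = ω k 1 + τ) := by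
    clear * - s1 hX1 hY1 h2 hk0 hpar hτ
    rcases hτ with hτ | hτ <;> (subst hτ; omega)
  rcases hA with ⟨hx2, hy2⟩ | ⟨hx2, hy2⟩
  · -- `(2,Y)`: `(3,Y)` or the turn `(2,Y−τ)` (dead, W1)
    right
    have hB : (ω (k + 3) 0 = 3 ∧ ω (k + 3) 1 = ω k 1) ∨ (ω (k + 3) 0 = 2 ∧ ω (k + 3) 1 = ω k 1 - τ) := by
      clear * - s2 hx2 hy2 hX1 hY1 h31 h3 hpar hτ
      rcases hτ with hτ | hτ <;> (subst hτ; omega)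
    rcases hB with ⟨hx3, hy3⟩ | hB
    · have hC : (ω (k + 4) 0 = 4 ∧ ω (k + 4) 1 = ω k 1) ∨ (ω (k + 4) 0 = 3 ∧ ω (k + 4) 1 = ω k 1 + τ) := by
        clear * - s3 hx3 hy3 hx2 hy2 h42 h4 hpar hτ
        rcases hτ with hτ | hτ <;> (subst hτ; omega)
      rcases hC with hC | hC
      · exact (fibA_nine_dead_W2a hk hω hτ hpar ⟨hQ0, hQY⟩ ⟨hx3, hy3⟩ hC).elim
      · obtain ⟨h5c, h6c, h7c, h8c, h9c⟩ := fibA_nine_W2b hω hτ hpar ⟨hX1, hY1⟩ ⟨hx3, hy3⟩ hC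
        exact ⟨hx2, hy2, hx3, hy3, hC.1, hC.2, h5c.1, h5c.2, h6c.1, h6c.2, h7c.1, h7c.2, h8c.1, h8c.2, h9c.1, h9c.2⟩
    · exact (fibA_nine_dead_W1 hk hω hal hτ hpar ⟨hQ0, hQY⟩ hctx ⟨hx2, hy2⟩ hB).elim
  · -- the skip start `(1,Y+τ)`: `(2,Y+τ)` forced; then `(2,Y+2τ)` (S1) or `(3,Y+τ)` (S2, dead)
    left
    have hX3 : ω (k + 3) 0 = 2 ∧ ω (k + 3) 1 = ω k 1 + τ := by
      clear * - s2 hx2 hy2 hX1 hY1 h31 h3 hk0 hpar hτ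
      rcases hτ with hτ | hτ <;> (subst hτ; constructor <;> omega)
    obtain ⟨hx3, hy3⟩ := hX3
    have hC : (ω (k + 4) 0 = 3 ∧ ω (k + 4) 1 = ω k 1 + τ) ∨ (ω (k + 4) 0 = 2 ∧ ω (k + 4) 1 = ω k 1 + 2 * τ) := by
      clear * - s3 hx3 hy3 hx2 hy2 h42 h4 hpar hτ
      rcases hτ with hτ | hτ <;> (subst hτ; omega)
    rcases hC with hC | ⟨hx4, hy4⟩
    · exact (fibA_nine_dead_S2 hk hω hτ hpar ⟨hX1, hY1⟩ ⟨hQ0, hQY⟩ ⟨hx3, hy3⟩ hC).elim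
    · have hD : (ω (k + 5) 0 = 3 ∧ ω (k + 5) 1 = ω k 1 + 2 * τ) ∨ (ω (k + 5) 0 = 1 ∧ ω (k + 5) 1 = ω k 1 + 2 * τ) := by
        clear * - s4 hx4 hy4 hx3 hy3 h53 h5 hpar hτ
        rcases hτ with hτ | hτ <;> (subst hτ; omega)
      rcases hD with hD | hD
      · obtain ⟨h6c, h7c, h8c, h9c⟩ := fibA_nine_S1b hω hτ hpar ⟨hx4, hy4⟩ hD
        exact ⟨hx2, hy2, hx3, hy3, hx4, hy4, hD.1, hD.2, h6c.1, h6c.2, h7c.1, h7c.2, h8c.1, h8c.2, h9c.1, h9c.2⟩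
      · exact (fibA_nine_dead_S1a hω hτ hpar ⟨hx4, hy4⟩ hD).elim

/-- The nine-fibre shapes in the prefix's own terms (`τ = Y_k − Y_{k−1}`). [cite: Beaton2014RotatedHoneycomb, §3.1 (arXiv v3 p. 12)] -/
theorem fibA_nine_coords₂ {k : ℕ} (hk : 3 ≤ k) (hω : ω ∈ fibA (k + 6) k) (hal : Alive2 (k + 9) ω) :
    ω (k - 1) 0 = 0 ∧ (ω (k + 1) 0 = 1 ∧ ω (k + 1) 1 = ω k 1) ∧
      ((ω (k + 2) 0 = 1 ∧ ω (k + 2) 1 = 2 * ω k 1 - ω (k - 1) 1 ∧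
          ω (k + 3) 0 = 2 ∧ ω (k + 3) 1 = 2 * ω k 1 - ω (k - 1) 1 ∧
          ω (k + 4) 0 = 2 ∧ ω (k + 4) 1 = 3 * ω k 1 - 2 * ω (k - 1) 1 ∧
          ω (k + 5) 0 = 3 ∧ ω (k + 5) 1 = 3 * ω k 1 - 2 * ω (k - 1) 1 ∧
          ω (k + 6) 0 = 3 ∧ ω (k + 6) 1 = 4 * ω k 1 - 3 * ω (k - 1) 1 ∧
          ω (k + 7) 0 = 2 ∧ ω (k + 7) 1 = 4 * ω k 1 - 3 * ω (k - 1) 1 ∧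
          ω (k + 8) 0 = 1 ∧ ω (k + 8) 1 = 4 * ω k 1 - 3 * ω (k - 1) 1 ∧
          ω (k + 9) 0 = 0 ∧ ω (k + 9) 1 = 4 * ω k 1 - 3 * ω (k - 1) 1) ∨
        (ω (k + 2) 0 = 2 ∧ ω (k + 2) 1 = ω k 1 ∧
          ω (k + 3) 0 = 3 ∧ ω (k + 3) 1 = ω k 1 ∧
          ω (k + 4) 0 = 3 ∧ ω (k + 4) 1 = 2 * ω k 1 - ω (k - 1) 1 ∧
          ω (k + 5) 0 = 2 ∧ ω (k + 5) 1 = 2 * ω k 1 - ω (k - 1) 1 ∧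
          ω (k + 6) 0 = 2 ∧ ω (k + 6) 1 = 3 * ω k 1 - 2 * ω (k - 1) 1 ∧
          ω (k + 7) 0 = 1 ∧ ω (k + 7) 1 = 3 * ω k 1 - 2 * ω (k - 1) 1 ∧
          ω (k + 8) 0 = 1 ∧ ω (k + 8) 1 = 4 * ω k 1 - 3 * ω (k - 1) 1 ∧
          ω (k + 9) 0 = 0 ∧ ω (k + 9) 1 = 4 * ω k 1 - 3 * ω (k - 1) 1)) := by
  obtain ⟨τ, hτ, hP0, hPY, hX1, hc⟩ := fibA_nine_coords hk hω hal
  refine ⟨hP0, hX1, ?_⟩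
  have eτ : τ = ω k 1 - ω (k - 1) 1 := by omega
  subst eτ
  rcases hc with h | h
  · left; refine ⟨h.1, ?_, h.2.2.1, ?_, h.2.2.2.2.1, ?_, h.2.2.2.2.2.2.1, ?_, h.2.2.2.2.2.2.2.2.1, ?_,
      h.2.2.2.2.2.2.2.2.2.2.1, ?_, h.2.2.2.2.2.2.2.2.2.2.2.2.1, ?_, h.2.2.2.2.2.2.2.2.2.2.2.2.2.2.1, ?_⟩ <;> omega
  · right; refine ⟨h.1, ?_, h.2.2.1, ?_, h.2.2.2.2.1, ?_, h.2.2.2.2.2.2.1, ?_, h.2.2.2.2.2.2.2.2.1, ?_,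
      h.2.2.2.2.2.2.2.2.2.2.1, ?_, h.2.2.2.2.2.2.2.2.2.2.2.2.1, ?_, h.2.2.2.2.2.2.2.2.2.2.2.2.2.2.1, ?_⟩ <;> omega

set_option maxHeartbeats 400000 in
open Classical in
/-- ★★ **The nine-fibre (two-step-alive part) weighs at most `2y · b_k(y)`** (`k ≥ 3`, `y ≥ 0`): the injection
`ω ↦ (prefix cut at k, [X_{k+2} = 1])` into `archesB3 k × Bool` (the prefix is three-step alive by the walk's own next three steps).
[cite: Beaton2014RotatedHoneycomb, §3.1 (arXiv v3 p. 12); HammersleyTorrieWhittington1982, §2 (locator provisional)] -/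
theorem sum_fibA_nine_le3 {k : ℕ} (hk : 3 ≤ k) (hy : 0 ≤ y) :
    ∑ ω ∈ (fibA (k + 6) k).filter (fun ω => Alive2 (k + 9) ω), y ^ visits (k + 9) ω ≤ 2 * y * b3W k y := by
  set F := (fibA (k + 6) k).filter (fun ω => Alive2 (k + 9) ω) with hF
  set g : (ℕ → Site 2) → (ℕ → Site 2) × Bool := fun ω => (Zd.prefixWalk k ω, decide (ω (k + 2) 0 = 1)) with hg
  have hprops : ∀ ω ∈ F, Zd.prefixWalk k ω ∈ archesB3 k ∧ visits (k + 9) ω = visits k (Zd.prefixWalk k ω) + 1 := by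
    intro ω hωF
    obtain ⟨hω, hal⟩ := Finset.mem_filter.1 hωF
    obtain ⟨hP0, -, -⟩ := fibA_nine_coords₂ hk hω hal
    obtain ⟨hωh, hend, -, hk0, hoff⟩ := fibA_anatomy hω
    rw [show k + 6 + 3 = k + 9 by omega] at hωh hend
    obtain ⟨hpa2, hpv⟩ := prefixWalk_mem_arches3 hωh (show k + 3 ≤ k + 9 by omega) hk0
    obtain ⟨hpa, hal3⟩ := Finset.mem_filter.1 hpa2
    have hv : ∀ i ≤ k, Zd.prefixWalk k ω i = ω i := fun i hi => by simp [Zd.prefixWalk, min_eq_left hi]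
    refine ⟨Finset.mem_filter.2 ⟨hpa, by rw [hv (k - 1) (by omega)]; exact hP0, hal3⟩, ?_⟩
    have e := visits_add_eq_left (k := k) (b := 8) (ζ := ω) (fun j hj1 hj8 => hoff (k + j) (by omega) (by omega))
    rw [show k + 9 = k + 8 + 1 by omega, visits_succ, if_pos (by rw [show k + 8 + 1 = k + 9 by omega]; exact hend), e, hpv]
  have hinj : Set.InjOn g ↑F := by
    intro ω hωF ω' hωF' h
    rw [Finset.mem_coe] at hωF hωF'
    obtain ⟨hω, hal⟩ := Finset.mem_filter.1 hωF
    obtain ⟨hω', hal'⟩ := Finset.mem_filter.1 hωF'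
    simp only [hg, Prod.mk.injEq] at h
    obtain ⟨h1, h2⟩ := h
    have hagree : ∀ i ≤ k, ω i = ω' i := fun i hi => by
      have := congrFun h1 i
      simpa [Zd.prefixWalk, min_eq_left hi] using this
    have hb : (ω (k + 2) 0 = 1) ↔ (ω' (k + 2) 0 = 1) := by simpa using h2
    have hωs : ω ∈ saws (k + 9) := by
      have := (fibA_anatomy hω).1; rw [show k + 6 + 3 = k + 9 by omega] at this; exact hp_subset this
    have hωs' : ω' ∈ saws (k + 9) := by
      have := (fibA_anatomy hω').1; rw [show k + 6 + 3 = k + 9 by omega] at this; exact hp_subset this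
    have eY : ω k 1 = ω' k 1 := by rw [hagree k le_rfl]
    have eYm : ω (k - 1) 1 = ω' (k - 1) 1 := by rw [hagree (k - 1) (by omega)]
    obtain ⟨-, ⟨hX1, hY1⟩, hc⟩ := fibA_nine_coords₂ hk hω hal
    obtain ⟨-, ⟨hX1', hY1'⟩, hc'⟩ := fibA_nine_coords₂ hk hω' hal'
    refine eq_of_agree hωs hωs' fun i hi => ?_
    rcases Nat.lt_or_ge i (k + 1) with hi' | hi'
    · exact hagree i (by omega)
    · rw [site_two_eq_iff]
      have hcase : i = k + 1 ∨ i = k + 2 ∨ i = k + 3 ∨ i = k + 4 ∨ i = k + 5 ∨ i = k + 6 ∨ i = k + 7 ∨ i = k + 8 ∨ i = k + 9 := by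
        omega
      rcases hc with ⟨a0, a1, b0, b1, c0, c1, d0, d1, e0, e1, f0, f1, g0, g1, i0, i1⟩ |
          ⟨a0, a1, b0, b1, c0, c1, d0, d1, e0, e1, f0, f1, g0, g1, i0, i1⟩ <;>
        rcases hc' with ⟨a0', a1', b0', b1', c0', c1', d0', d1', e0', e1', f0', f1', g0', g1', i0', i1'⟩ |
          ⟨a0', a1', b0', b1', c0', c1', d0', d1', e0', e1', f0', f1', g0', g1', i0', i1'⟩
      · rcases hcase with rfl | rfl | rfl | rfl | rfl | rfl | rfl | rfl | rfl
        · exact ⟨by rw [hX1, hX1'], by rw [hY1, hY1', eY]⟩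
        · exact ⟨by rw [a0, a0'], by rw [a1, a1', eY, eYm]⟩
        · exact ⟨by rw [b0, b0'], by rw [b1, b1', eY, eYm]⟩
        · exact ⟨by rw [c0, c0'], by rw [c1, c1', eY, eYm]⟩
        · exact ⟨by rw [d0, d0'], by rw [d1, d1', eY, eYm]⟩
        · exact ⟨by rw [e0, e0'], by rw [e1, e1', eY, eYm]⟩
        · exact ⟨by rw [f0, f0'], by rw [f1, f1', eY, eYm]⟩
        · exact ⟨by rw [g0, g0'], by rw [g1, g1', eY, eYm]⟩
        · exact ⟨by rw [i0, i0'], by rw [i1, i1', eY, eYm]⟩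
      · exfalso; rw [a0, a0'] at hb; norm_num at hb
      · exfalso; rw [a0, a0'] at hb; norm_num at hb
      · rcases hcase with rfl | rfl | rfl | rfl | rfl | rfl | rfl | rfl | rfl
        · exact ⟨by rw [hX1, hX1'], by rw [hY1, hY1', eY]⟩
        · exact ⟨by rw [a0, a0'], by rw [a1, a1', eY]⟩
        · exact ⟨by rw [b0, b0'], by rw [b1, b1', eY]⟩
        · exact ⟨by rw [c0, c0'], by rw [c1, c1', eY, eYm]⟩
        · exact ⟨by rw [d0, d0'], by rw [d1, d1', eY, eYm]⟩
        · exact ⟨by rw [e0, e0'], by rw [e1, e1', eY, eYm]⟩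
        · exact ⟨by rw [f0, f0'], by rw [f1, f1', eY, eYm]⟩
        · exact ⟨by rw [g0, g0'], by rw [g1, g1', eY, eYm]⟩
        · exact ⟨by rw [i0, i0'], by rw [i1, i1', eY, eYm]⟩
  calc ∑ ω ∈ F, y ^ visits (k + 9) ω = ∑ ω ∈ F, y * y ^ visits k (g ω).1 :=
        Finset.sum_congr rfl fun ω hω => by simp only [hg]; rw [(hprops ω hω).2, pow_succ, mul_comm]
    _ = ∑ p ∈ F.image g, y * y ^ visits k p.1 := by rw [Finset.sum_image hinj]
    _ ≤ ∑ p ∈ archesB3 k ×ˢ (Finset.univ : Finset Bool), y * y ^ visits k p.1 := by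
        refine Finset.sum_le_sum_of_subset_of_nonneg (fun p hp' => ?_) fun _ _ _ => mul_nonneg hy (pow_nonneg hy _)
        obtain ⟨ω, hω, rfl⟩ := Finset.mem_image.1 hp'
        exact Finset.mem_product.2 ⟨(hprops ω hω).1, Finset.mem_univ _⟩
    _ = 2 * y * b3W k y := by
        rw [Finset.sum_product, b3W, Finset.mul_sum]
        refine Finset.sum_congr rfl fun ξ _ => ?_
        simp only [Finset.sum_const, Finset.card_univ, Fintype.card_bool, nsmul_eq_mul]
        push_cast
        ring

/-! ### §6  The three-step-alive recursion and the growth bound -/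

open Classical in
/-- **`a_{j+12} ≤ y b_{j+9} + 2y b_{j+5} + 2y b_{j+3} + y Σ_{k ≤ j+2} X_k c_{j+11−k}(ℍ)`** (`y ≥ 0`; three-step-alive classes).  Fibres by
the last-but-one wall visit `k ≤ j+11`: `j+11, j+10` empty; `j+9` the connector; `j+8, j+7` empty (no excursions of length 4, 5); `j+6`
dead (six, two-step); `j+5` the two sevens; `j+4` EMPTY (the eight is dead in three steps); `j+3` the two nines; `k ≤ j+2` generic.
[cite: HammersleyTorrieWhittington1982, §2 (as summarised by Beaton 2014 arXiv v3 p. 11; locator provisional); MadrasSlade1993, §1.2, (1.2.3)] -/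
theorem a3W_le_rec (j : ℕ) (hy : 0 ≤ y) :
    a3W (j + 12) y ≤ y * b3W (j + 9) y + 2 * y * b3W (j + 5) y + 2 * y * b3W (j + 3) y +
      y * ∑ k ∈ range (j + 3), aX3w k y * #(saws (j + 11 - k)) := by
  set T : ℕ → ℝ := fun k => ∑ ω ∈ (archesA3 (j + 12)).filter (fun ω => lastV (j + 11) ω = k), y ^ visits (j + 12) ω with hT
  have hdec : a3W (j + 12) y = ∑ k ∈ range (j + 12), T k := by
    have hf : ∀ ω ∈ archesA3 (j + 12), lastV (j + 11) ω ∈ range (j + 12) :=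
      fun ω _ => Finset.mem_range.2 (Nat.lt_succ_of_le (lastV_le _ _))
    rw [a3W, ← Finset.sum_fiberwise_of_maps_to hf]
  have hsub : ∀ k, (archesA3 (j + 12)).filter (fun ω => lastV (j + 11) ω = k) ⊆ fibA (j + 9) k := by
    intro k ω hω
    obtain ⟨hωA, hk⟩ := Finset.mem_filter.1 hω
    obtain ⟨hωa, hA, -⟩ := Finset.mem_filter.1 hωA
    exact Finset.mem_filter.2 ⟨Finset.mem_filter.2 ⟨hωa, hA⟩, hk⟩
  have hsub2 : ∀ k, (archesA3 (j + 12)).filter (fun ω => lastV (j + 11) ω = k) ⊆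
      (fibA (j + 9) k).filter (fun ω => Alive2 (j + 12) ω) := by
    intro k ω hω
    obtain ⟨hωA, -⟩ := Finset.mem_filter.1 hω
    obtain ⟨-, -, hal⟩ := Finset.mem_filter.1 hωA
    exact Finset.mem_filter.2 ⟨hsub k hω, hal.alive2⟩
  have hTle : ∀ k, T k ≤ ∑ ω ∈ fibA (j + 9) k, y ^ visits (j + 12) ω := fun k =>
    Finset.sum_le_sum_of_subset_of_nonneg (hsub k) fun _ _ _ => pow_nonneg hy _
  have hTnn : ∀ k, 0 ≤ T k := fun k => Finset.sum_nonneg fun _ _ => pow_nonneg hy _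
  have h11 : T (j + 11) ≤ 0 := by
    refine (hTle _).trans ?_; rw [show j + 11 = j + 9 + 2 by omega, fibA_top_eq_empty, Finset.sum_empty]
  have h10 : T (j + 10) ≤ 0 := by
    refine (hTle _).trans ?_; rw [show j + 10 = j + 9 + 1 by omega, fibA_pred_eq_empty, Finset.sum_empty]
  have h9 : T (j + 9) ≤ y * b3W (j + 9) y := (hTle _).trans (sum_fibA_self_le_b3W (j + 9) hy)
  have h8 : T (j + 8) ≤ 0 := by
    refine (hTle _).trans (le_of_eq (Finset.sum_eq_zero fun ω hω => ?_))
    exact absurd hω (not_mem_fibA_four (j + 8) ω)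
  have h7 : T (j + 7) ≤ 0 := by
    refine (hTle _).trans (le_of_eq (Finset.sum_eq_zero fun ω hω => ?_))
    exact absurd hω (not_mem_fibA_five (k := j + 7) (by omega) ω)
  have h6 : T (j + 6) ≤ 0 := by
    refine le_of_eq (Finset.sum_eq_zero fun ω hω => ?_)
    obtain ⟨hωA, hk⟩ := Finset.mem_filter.1 hω
    obtain ⟨-, -, hal⟩ := Finset.mem_filter.1 hωA
    exact absurd hal.alive2 (not_alive_of_mem_fibA_six (k := j + 6) (by omega) (hsub _ hω))
  have h5 : T (j + 5) ≤ 2 * y * b3W (j + 5) y := (hTle _).trans (sum_fibA_seven_le3 (k := j + 5) (by omega) hy)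
  have h4 : T (j + 4) ≤ 0 := by
    refine le_of_eq (Finset.sum_eq_zero fun ω hω => ?_)
    obtain ⟨hωA, hk⟩ := Finset.mem_filter.1 hω
    obtain ⟨-, -, hal⟩ := Finset.mem_filter.1 hωA
    exact absurd hal (not_alive3_of_mem_fibA_eight (k := j + 4) (by omega) (hsub _ hω))
  have h3 : T (j + 3) ≤ 2 * y * b3W (j + 3) y :=
    (Finset.sum_le_sum_of_subset_of_nonneg (hsub2 (j + 3)) fun _ _ _ => pow_nonneg hy _).trans
      (sum_fibA_nine_le3 (k := j + 3) (by omega) hy)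
  have hlow : ∑ k ∈ range (j + 3), T k ≤ y * ∑ k ∈ range (j + 3), aX3w k y * #(saws (j + 11 - k)) := by
    rw [Finset.mul_sum]
    refine Finset.sum_le_sum fun k hk => (hTle k).trans ?_
    have hk' := Finset.mem_range.1 hk
    have := sum_fibA_le_X3a (j + 9) hy (k := k) (by omega)
    rwa [show j + 9 + 2 - k = j + 11 - k by omega] at this
  rw [hdec, Finset.sum_range_succ, Finset.sum_range_succ, Finset.sum_range_succ, Finset.sum_range_succ, Finset.sum_range_succ,
    Finset.sum_range_succ, Finset.sum_range_succ, Finset.sum_range_succ, Finset.sum_range_succ]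
  linarith [hTnn (j + 11), hTnn (j + 10)]

open Classical in
/-- `a_n ≤ A_n`. [cite: HammersleyTorrieWhittington1982, §2] -/
theorem a3W_le_Aw (n : ℕ) (hy : 0 ≤ y) : a3W n y ≤ Aw n y :=
  (a3W_le_aX3w n hy).trans (aX3w_le_Aw n hy)

open Classical in
/-- `b_n ≤ A_n`. [cite: HammersleyTorrieWhittington1982, §2] -/
theorem b3W_le_Aw (n : ℕ) (hy : 0 ≤ y) : b3W n y ≤ Aw n y :=
  (b3W_le_aX3w n hy).trans (aX3w_le_Aw n hy)

set_option maxHeartbeats 400000 in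
/-- **Growth bound** (`y ≥ 1`, `ρ ≥ 6`, `y²ρ⁸ + 2y²ρ⁴ + 2y²ρ² + 39366yρ² + 216513y²ρ ≤ ρ¹²`): `a_n ≤ 3¹²y¹³ρⁿ`, `b_n ≤ 3¹²y¹⁴ρ^{n−1}`
(`39366 = 2·3⁹`, `216513 = 2·3⁹ + 3¹¹`). [cite: MadrasSlade1993, §1.2, Lemma 1.2.2; HammersleyTorrieWhittington1982, §2] -/
theorem a3W_b3W_le_mul_pow (hy : 1 ≤ y) {ρ : ℝ} (hρ : 6 ≤ ρ)
    (hc : y ^ 2 * ρ ^ 8 + 2 * y ^ 2 * ρ ^ 4 + 2 * y ^ 2 * ρ ^ 2 + 39366 * y * ρ ^ 2 + 216513 * y ^ 2 * ρ ≤ ρ ^ 12) (n : ℕ) :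
    a3W n y ≤ 3 ^ 12 * y ^ 13 * ρ ^ n ∧ b3W n y ≤ 3 ^ 12 * y ^ 13 * y * ρ ^ (n - 1) := by
  have hy0 : 0 ≤ y := by linarith
  have hρ1 : 1 ≤ ρ := by linarith
  have hρ0 : 0 < ρ := by linarith
  have hρ3 : (3 : ℝ) ≤ ρ := by linarith
  set K : ℝ := 3 ^ 12 * y ^ 13 with hK
  have hK0 : 0 ≤ K := by positivity
  have hapr : ∀ n ≤ 11, Aw n y ≤ K ∧ Aw n y ≤ K * y := by
    intro n hn
    have h1 := Aw_le_card_mul_pow n hy0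
    rw [max_eq_right hy] at h1
    have h2 : (#(saws n) : ℝ) * y ^ (n + 1) ≤ 3 ^ n * y ^ (n + 1) :=
      mul_le_mul_of_nonneg_right (card_saws_le_three_pow n) (pow_nonneg hy0 _)
    have h3 : (3 : ℝ) ^ n ≤ 3 ^ 12 := pow_le_pow_right₀ (by norm_num) (by omega)
    have h4 : y ^ (n + 1) ≤ y ^ 13 := pow_le_pow_right₀ hy (by omega)
    have hA : Aw n y ≤ K := (h1.trans h2).trans (mul_le_mul h3 h4 (pow_nonneg hy0 _) (by positivity))
    exact ⟨hA, hA.trans (le_mul_of_one_le_right hK0 hy)⟩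
  induction n using Nat.strong_induction_on with
  | _ n ih =>
  rcases Nat.lt_or_ge n 12 with hn | hn
  · obtain ⟨hA, hAy⟩ := hapr n (by omega)
    have h5 : (1 : ℝ) ≤ ρ ^ n := one_le_pow₀ hρ1
    have h6 : (1 : ℝ) ≤ ρ ^ (n - 1) := one_le_pow₀ hρ1
    refine ⟨(a3W_le_Aw n hy0).trans (hA.trans ?_), (b3W_le_Aw n hy0).trans (hAy.trans ?_)⟩
    · calc K = K * 1 := (mul_one _).symm
        _ ≤ K * ρ ^ n := mul_le_mul_of_nonneg_left h5 hK0
    · calc K * y = K * y * 1 := (mul_one _).symm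
        _ ≤ K * y * ρ ^ (n - 1) := mul_le_mul_of_nonneg_left h6 (by positivity)
  · obtain ⟨j, rfl⟩ : ∃ j, n = j + 12 := ⟨n - 12, by omega⟩
    have ha : ∀ k < j + 12, a3W k y ≤ K * ρ ^ k := fun k hk => (ih k hk).1
    have hb : ∀ k < j + 12, b3W k y ≤ K * y * ρ ^ (k - 1) := fun k hk => (ih k hk).2
    have hB : b3W (j + 12) y ≤ K * y * ρ ^ (j + 12 - 1) := by
      have h1 := b3W_le (j + 10) hy0
      rw [show j + 10 + 2 = j + 12 by omega, show j + 10 + 1 = j + 11 by omega] at h1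
      have h2 := ha (j + 11) (by omega)
      rw [show j + 12 - 1 = j + 11 by omega]
      calc b3W (j + 12) y ≤ y * a3W (j + 11) y := h1
        _ ≤ y * (K * ρ ^ (j + 11)) := mul_le_mul_of_nonneg_left h2 hy0
        _ = K * y * ρ ^ (j + 11) := by ring
    refine ⟨?_, hB⟩
    have hrec := a3W_le_rec j hy0
    have hb9 := hb (j + 9) (by omega)
    rw [show j + 9 - 1 = j + 8 by omega] at hb9
    have hb5 := hb (j + 5) (by omega)
    rw [show j + 5 - 1 = j + 4 by omega] at hb5
    have hb3 := hb (j + 3) (by omega)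
    rw [show j + 3 - 1 = j + 2 by omega] at hb3
    have hX : ∀ k < j + 3, aX3w k y * (#(saws (j + 11 - k)) : ℝ) ≤
        K * (ρ ^ k * 3 ^ (j + 2 + 9 - k)) + K * y * (ρ ^ (k - 1) * 3 ^ (j + 11 - k)) := by
      intro k hk
      have h1 : aX3w k y ≤ K * ρ ^ k + K * y * ρ ^ (k - 1) := by
        rw [aX3w_eq]; exact add_le_add (ha k (by omega)) (hb k (by omega))
      have h2 : (#(saws (j + 11 - k)) : ℝ) ≤ 3 ^ (j + 11 - k) := card_saws_le_three_pow _
      calc aX3w k y * (#(saws (j + 11 - k)) : ℝ) ≤ (K * ρ ^ k + K * y * ρ ^ (k - 1)) * 3 ^ (j + 11 - k) :=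
            mul_le_mul h1 h2 (Nat.cast_nonneg _) (by positivity)
        _ = K * (ρ ^ k * 3 ^ (j + 2 + 9 - k)) + K * y * (ρ ^ (k - 1) * 3 ^ (j + 11 - k)) := by
            rw [show j + 2 + 9 - k = j + 11 - k by omega]; ring
    have hS1 : ∑ k ∈ range (j + 3), ρ ^ k * (3 : ℝ) ^ (j + 2 + 9 - k) ≤ 2 * 3 ^ 9 * ρ ^ (j + 2) :=
      sum_pow_mul_three_pow_le hρ (j + 2) 9
    have hS2 : ∑ k ∈ range (j + 3), ρ ^ (k - 1) * (3 : ℝ) ^ (j + 11 - k) ≤ 216513 * ρ ^ (j + 1) := by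
      rw [Finset.sum_range_succ']
      simp only [Nat.zero_sub, pow_zero, one_mul, Nat.sub_zero, Nat.add_sub_cancel]
      have e : ∑ i ∈ range (j + 2), ρ ^ i * (3 : ℝ) ^ (j + 11 - (i + 1)) = ∑ i ∈ range (j + 2), ρ ^ i * (3 : ℝ) ^ (j + 1 + 9 - i) :=
        Finset.sum_congr rfl fun i _ => by rw [show j + 11 - (i + 1) = j + 1 + 9 - i by omega]
      rw [e]
      have h1 := sum_pow_mul_three_pow_le hρ (j + 1) 9
      have h2 : (3 : ℝ) ^ (j + 11) ≤ 3 ^ 11 * ρ ^ (j + 1) := by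
        have : (3 : ℝ) ^ (j + 1) ≤ ρ ^ (j + 1) := pow_le_pow_left₀ (by norm_num) hρ3 (j + 1)
        rw [show j + 11 = 10 + (j + 1) by omega, pow_add]
        nlinarith [pow_nonneg hρ0.le (j + 1)]
      nlinarith [pow_nonneg hρ0.le (j + 1)]
    have htail : ∑ k ∈ range (j + 3), aX3w k y * (#(saws (j + 11 - k)) : ℝ) ≤
        K * (2 * 3 ^ 9 * ρ ^ (j + 2)) + K * y * (216513 * ρ ^ (j + 1)) := by
      calc ∑ k ∈ range (j + 3), aX3w k y * (#(saws (j + 11 - k)) : ℝ)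
          ≤ ∑ k ∈ range (j + 3), (K * (ρ ^ k * 3 ^ (j + 2 + 9 - k)) + K * y * (ρ ^ (k - 1) * 3 ^ (j + 11 - k))) :=
            Finset.sum_le_sum fun k hk => hX k (Finset.mem_range.1 hk)
        _ = K * ∑ k ∈ range (j + 3), ρ ^ k * 3 ^ (j + 2 + 9 - k) + K * y * ∑ k ∈ range (j + 3), ρ ^ (k - 1) * 3 ^ (j + 11 - k) := by
            rw [Finset.sum_add_distrib, Finset.mul_sum, Finset.mul_sum]
        _ ≤ K * (2 * 3 ^ 9 * ρ ^ (j + 2)) + K * y * (216513 * ρ ^ (j + 1)) :=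
            add_le_add (mul_le_mul_of_nonneg_left hS1 hK0) (mul_le_mul_of_nonneg_left hS2 (by positivity))
    have hmain : y * (K * y * ρ ^ (j + 8)) + 2 * y * (K * y * ρ ^ (j + 4)) + 2 * y * (K * y * ρ ^ (j + 2)) +
        y * (K * (2 * 3 ^ 9 * ρ ^ (j + 2)) + K * y * (216513 * ρ ^ (j + 1))) ≤ K * ρ ^ (j + 12) := by
      have e1 : y * (K * y * ρ ^ (j + 8)) + 2 * y * (K * y * ρ ^ (j + 4)) + 2 * y * (K * y * ρ ^ (j + 2)) +
          y * (K * (2 * 3 ^ 9 * ρ ^ (j + 2)) + K * y * (216513 * ρ ^ (j + 1))) =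
          K * ρ ^ j * (y ^ 2 * ρ ^ 8 + 2 * y ^ 2 * ρ ^ 4 + 2 * y ^ 2 * ρ ^ 2 + 39366 * y * ρ ^ 2 + 216513 * y ^ 2 * ρ) := by ring
      have e2 : K * ρ ^ (j + 12) = K * ρ ^ j * ρ ^ 12 := by ring
      rw [e1, e2]
      exact mul_le_mul_of_nonneg_left hc (by positivity)
    calc a3W (j + 12) y ≤ y * b3W (j + 9) y + 2 * y * b3W (j + 5) y + 2 * y * b3W (j + 3) y +
          y * ∑ k ∈ range (j + 3), aX3w k y * #(saws (j + 11 - k)) := hrec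
      _ ≤ y * (K * y * ρ ^ (j + 8)) + 2 * y * (K * y * ρ ^ (j + 4)) + 2 * y * (K * y * ρ ^ (j + 2)) +
            y * (K * (2 * 3 ^ 9 * ρ ^ (j + 2)) + K * y * (216513 * ρ ^ (j + 1))) := by
          have := mul_le_mul_of_nonneg_left hb9 hy0
          have := mul_le_mul_of_nonneg_left hb5 (by positivity : (0 : ℝ) ≤ 2 * y)
          have := mul_le_mul_of_nonneg_left hb3 (by positivity : (0 : ℝ) ≤ 2 * y)
          have := mul_le_mul_of_nonneg_left htail hy0
          linarith
      _ ≤ K * ρ ^ (j + 12) := hmain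

/-- **From the growth bound to the growth rate**: if `ρ ≥ 6` satisfies the growth condition then `β_rot(y) ≤ ρ` (`y ≥ 1`).
[cite: MadrasSlade1993, §1.2, Lemma 1.2.2, (1.2.10)] -/
theorem armRate_le_of_growth (hy : 1 ≤ y) {ρ : ℝ} (hρ : 6 ≤ ρ)
    (hc : y ^ 2 * ρ ^ 8 + 2 * y ^ 2 * ρ ^ 4 + 2 * y ^ 2 * ρ ^ 2 + 39366 * y * ρ ^ 2 + 216513 * y ^ 2 * ρ ≤ ρ ^ 12) :
    armRate y ≤ ρ := by
  have hy0 : 0 < y := by linarith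
  have hρ1 : 1 ≤ ρ := by linarith
  set K : ℝ := 3 ^ 12 * y ^ 13 with hK
  have hK0 : 0 < K := by positivity
  have hgrowth := a3W_b3W_le_mul_pow hy hρ hc
  have hWB : ∀ n, WB n y ≤ K * (1 + y) * ρ ^ n := by
    intro n
    rcases Nat.eq_zero_or_pos n with hn | hn
    · subst hn
      have h1 := (WB_le_Aw 0 hy0.le).trans (Aw_le_card_mul_pow 0 hy0.le)
      rw [max_eq_right hy] at h1
      have h2 : (#(saws 0) : ℝ) ≤ 3 ^ 0 := card_saws_le_three_pow 0
      simp only [zero_add, pow_one, pow_zero] at h1 h2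
      have h3 : WB 0 y ≤ y := h1.trans (by nlinarith [mul_le_mul_of_nonneg_right h2 hy0.le])
      have h4 : y ≤ K * (1 + y) * ρ ^ 0 := by
        rw [pow_zero, mul_one]
        have hK1 : (1 : ℝ) ≤ K := by
          rw [hK]; exact one_le_mul_of_one_le_of_one_le (by norm_num) (one_le_pow₀ hy)
        nlinarith [mul_nonneg (sub_nonneg.2 hK1) hy0.le]
      exact h3.trans h4
    · obtain ⟨ha, hb⟩ := hgrowth n
      have h1 := WB_le_aX3w hn hy0.le (n := n)
      rw [aX3w_eq] at h1
      have h2 : ρ ^ (n - 1) ≤ ρ ^ n := pow_le_pow_right₀ hρ1 (by omega)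
      have h3 : b3W n y ≤ K * y * ρ ^ n := hb.trans (mul_le_mul_of_nonneg_left h2 (by positivity))
      calc WB n y ≤ a3W n y + b3W n y := h1
        _ ≤ K * ρ ^ n + K * y * ρ ^ n := add_le_add ha h3
        _ = K * (1 + y) * ρ ^ n := by ring
  exact armRate_le_of_WB_le hy0 (by positivity : 0 < K * (1 + y)) (by linarith) hWB

/-! ### §7  The third-order UPPER bound: `β_rot(y)⁴ ≤ y² + 2 + 2/y + 423188/(y√y)` (`y ≥ 10⁴`) -/

set_option maxHeartbeats 400000 in
/-- Facts about `t := (y² + 2 + 2/y + 423188/(y√y))^{1/4}` (`y ≥ 10⁴`): `t ≥ 6`, `t⁴ = …`, and the growth condition of `a3W_b3W_le_mul_pow`.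
[cite: MadrasSlade1993, §1.2, Lemma 1.2.2] -/
theorem rho_facts₃ (hy : 10000 ≤ y) :
    let t := Real.sqrt (Real.sqrt (y ^ 2 + 2 + 2 / y + 423188 / (y * Real.sqrt y)))
    0 < t ∧ 6 ≤ t ∧ t ^ 4 = y ^ 2 + 2 + 2 / y + 423188 / (y * Real.sqrt y) ∧
      y ^ 2 * t ^ 8 + 2 * y ^ 2 * t ^ 4 + 2 * y ^ 2 * t ^ 2 + 39366 * y * t ^ 2 + 216513 * y ^ 2 * t ≤ t ^ 12 := by
  intro t
  have hy1 : 1 ≤ y := by linarith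
  have hy0 : 0 < y := by linarith
  set s := Real.sqrt y with hs
  have hs0 : 0 < s := Real.sqrt_pos.2 hy0
  have hys : y = s ^ 2 := (Real.sq_sqrt hy0.le).symm
  have hs100 : 100 ≤ s := by
    rw [hs, show (100 : ℝ) = Real.sqrt (100 ^ 2) by rw [Real.sqrt_sq (by norm_num)]]
    exact Real.sqrt_le_sqrt (by linarith)
  set D := 2 + 2 / y + 423188 / (y * s) with hD
  set R := y ^ 2 + 2 + 2 / y + 423188 / (y * s) with hR
  have hRD : R = y ^ 2 + D := by rw [hR, hD]; ring
  have hD2 : 2 ≤ D := by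
    have h1 : (0 : ℝ) ≤ 2 / y := by positivity
    have h2 : (0 : ℝ) ≤ 423188 / (y * s) := by positivity
    rw [hD]; linarith
  have hD3 : D ≤ 3 := by
    rw [hD]
    have h1 : 2 / y ≤ 2 / 10000 := div_le_div_of_nonneg_left (by norm_num) (by norm_num) hy
    have h2 : 423188 / (y * s) ≤ 423188 / (10000 * 100) :=
      div_le_div_of_nonneg_left (by norm_num) (by norm_num) (mul_le_mul hy hs100 (by norm_num) hy0.le)
    norm_num at h1 h2 ⊢; linarith
  have hD0 : 0 ≤ D := by linarith
  have hRy : y ^ 2 ≤ R := by rw [hRD]; linarith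
  have hR0 : 0 ≤ R := le_trans (by positivity) hRy
  -- `u = t² = √R`, `t⁴ = R`
  set u := Real.sqrt R with hu
  have hu0 : 0 ≤ u := Real.sqrt_nonneg _
  have hu2 : u ^ 2 = R := Real.sq_sqrt hR0
  have ht0 : 0 ≤ t := Real.sqrt_nonneg _
  have ht2 : t ^ 2 = u := Real.sq_sqrt hu0
  have ht4 : t ^ 4 = R := by rw [show t ^ 4 = (t ^ 2) ^ 2 by ring, ht2, hu2]
  -- `t ≥ 6` (indeed `t ≥ 100`): `t⁴ ≥ y² ≥ 10⁸`
  have ht6 : 6 ≤ t := by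
    by_contra h
    push Not at h
    have : t ^ 4 < 6 ^ 4 := pow_lt_pow_left₀ h ht0 (by norm_num)
    rw [ht4] at this; nlinarith [hRy]
  have htpos : 0 < t := by linarith
  refine ⟨htpos, ht6, ht4, ?_⟩
  -- upper bounds for `u` and `t`
  have huU : u ≤ y + D / (2 * y) := by
    have h1 : R ≤ (y + D / (2 * y)) ^ 2 := by
      have e : (y + D / (2 * y)) ^ 2 = y ^ 2 + D + (D / (2 * y)) ^ 2 := by field_simp; ring
      rw [e, hRD]; nlinarith [sq_nonneg (D / (2 * y))]
    calc u = Real.sqrt R := hu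
      _ ≤ Real.sqrt ((y + D / (2 * y)) ^ 2) := Real.sqrt_le_sqrt h1
      _ = y + D / (2 * y) := Real.sqrt_sq (by positivity)
  have hu2y : u ≤ 2 * y := by
    have : D / (2 * y) ≤ y := by rw [div_le_iff₀ (by positivity)]; nlinarith
    linarith
  have htS : t ≤ 3 / 2 * s := by
    have h1 : u ≤ (3 / 2 * s) ^ 2 := by rw [mul_pow, ← hys]; nlinarith
    calc t = Real.sqrt u := by rw [ht2.symm, Real.sqrt_sq ht0]
      _ ≤ Real.sqrt ((3 / 2 * s) ^ 2) := Real.sqrt_le_sqrt h1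
      _ = 3 / 2 * s := Real.sqrt_sq (by positivity)
  -- the right-hand side of the condition
  have hRHS : (2 * y ^ 2 + 39366 * y) * u + 216513 * y ^ 2 * t ≤
      2 * y ^ 3 + y * D + 39366 * y ^ 2 + 19683 * D + 324770 * y ^ 2 * s := by
    have h1 : (2 * y ^ 2 + 39366 * y) * u ≤ (2 * y ^ 2 + 39366 * y) * (y + D / (2 * y)) :=
      mul_le_mul_of_nonneg_left huU (by positivity)
    have e1 : (2 * y ^ 2 + 39366 * y) * (y + D / (2 * y)) = 2 * y ^ 3 + y * D + 39366 * y ^ 2 + 19683 * D := by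
      field_simp; ring
    have h2 : 216513 * y ^ 2 * t ≤ 216513 * y ^ 2 * (3 / 2 * s) := mul_le_mul_of_nonneg_left htS (by positivity)
    nlinarith [mul_nonneg (mul_nonneg (by norm_num : (0:ℝ) ≤ 216513) (sq_nonneg y)) hs0.le]
  -- the left-hand side
  have hLHS : y ^ 4 * (D - 2) + y ^ 2 * D ^ 2 ≤ R ^ 3 - y ^ 2 * R ^ 2 - 2 * y ^ 2 * R := by
    have e : R ^ 3 - y ^ 2 * R ^ 2 - 2 * y ^ 2 * R = R * (y ^ 2 * (D - 2) + D ^ 2) := by rw [hRD]; ring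
    rw [e]
    have hb0 : 0 ≤ y ^ 2 * (D - 2) + D ^ 2 := by nlinarith
    have := mul_le_mul_of_nonneg_right hRy hb0
    nlinarith
  have hkey : y ^ 4 * (D - 2) = 2 * y ^ 3 + 423188 * y ^ 2 * s := by
    have e : D - 2 = 2 / y + 423188 / (y * s) := by rw [hD]; ring
    rw [e, hys]; field_simp; try ring
  -- absorb the constants: `yD + 39366y² + 19683D + 324770y²s ≤ 423188 y² s` (`D ≤ 3`, `s ≥ 100`, `y = s²`)
  have habs : y * D + 39366 * y ^ 2 + 19683 * D + 324770 * y ^ 2 * s ≤ 423188 * y ^ 2 * s + y ^ 2 * D ^ 2 := by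
    have hs1 : 1 ≤ s := by linarith
    have hyy : y ≤ y ^ 2 * s := by
      calc y = y * 1 * 1 := by ring
        _ ≤ y * y * s := mul_le_mul (mul_le_mul_of_nonneg_left hy1 hy0.le) hs1 (by norm_num) (by positivity)
        _ = y ^ 2 * s := by ring
    have h1y : (1 : ℝ) ≤ y ^ 2 * s := le_trans hy1 hyy
    have h1 : y * D ≤ 3 * (y ^ 2 * s) := by
      calc y * D ≤ y * 3 := mul_le_mul_of_nonneg_left hD3 hy0.le
        _ ≤ 3 * (y ^ 2 * s) := by linarith
    have h2 : 39366 * y ^ 2 ≤ 39366 * (y ^ 2 * s) := by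
      have : y ^ 2 ≤ y ^ 2 * s := le_mul_of_one_le_right (sq_nonneg y) hs1
      linarith
    have h3 : 19683 * D ≤ 59049 * (y ^ 2 * s) := by nlinarith
    have h4 : 0 ≤ y ^ 2 * D ^ 2 := by positivity
    linarith
  -- assemble
  have e8 : t ^ 8 = R ^ 2 := by rw [show t ^ 8 = (t ^ 4) ^ 2 by ring, ht4]
  have e12 : t ^ 12 = R ^ 3 := by rw [show t ^ 12 = (t ^ 4) ^ 3 by ring, ht4]
  rw [e8, ht4, e12, ht2]
  linarith

/-- ★★★ **Third-order UPPER bound for the armchair (rotated-honeycomb) surface growth rate**: `β_rot(y)⁴ ≤ y² + 2 + 2/y + 423188/(y√y)`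
for `y ≥ 10⁴` — with the matching lower bound of «ARM-THIRD-ORDER-LOWER» (`β_rot⁴ ≥ y² + 2 + 2/y − O(y⁻²)`) this identifies the THIRD
coefficient of Beaton's armchair adsorbed-phase expansion: `β_rot(y)² = y + 1/y + 1/y² + O(y^{−5/2})` (three-step-alive arches: per slot
ONE skip excursion and ONE wide connector at length 7, NOTHING alive at length 8, exactly the TWO nine-step defects at length 9).
[cite: Beaton2014RotatedHoneycomb, §3 (arXiv v3 pp. 10–11), §3.1 (p. 12); HammersleyTorrieWhittington1982, §2; MadrasSlade1993, §1.2, Lemma 1.2.2, (1.2.17)] -/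
theorem armRate_pow_four_le_third (hy : 10000 ≤ y) : armRate y ^ 4 ≤ y ^ 2 + 2 + 2 / y + 423188 / (y * Real.sqrt y) := by
  obtain ⟨ht0, ht6, ht4, hc⟩ := rho_facts₃ hy
  have hβ := armRate_le_of_growth (by linarith) ht6 hc
  calc armRate y ^ 4 ≤ (Real.sqrt (Real.sqrt (y ^ 2 + 2 + 2 / y + 423188 / (y * Real.sqrt y)))) ^ 4 :=
        pow_le_pow_left₀ (armRate_pos y).le hβ 4
    _ = y ^ 2 + 2 + 2 / y + 423188 / (y * Real.sqrt y) := ht4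

/-- ★★★ **`β_rot(y)² ≤ y + 1/y + 1/y² + 211595/(y²√y)`** (`y ≥ 10⁴`): from `β_rot⁴ ≤ y² + D`, `β_rot² ≤ y + D/(2y)`.
[cite: Beaton2014RotatedHoneycomb, §3.1 (arXiv v3 p. 12); MadrasSlade1993, §1.2, (1.2.17)] -/
theorem armRate_sq_le_third (hy : 10000 ≤ y) : armRate y ^ 2 ≤ y + 1 / y + 1 / y ^ 2 + 211595 / (y ^ 2 * Real.sqrt y) := by
  have hy0 : 0 < y := by linarith
  have hs0 : 0 < Real.sqrt y := Real.sqrt_pos.2 hy0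
  have h4 := armRate_pow_four_le_third hy
  set D := 2 + 2 / y + 423188 / (y * Real.sqrt y) with hD
  have hD0 : 0 ≤ D := by positivity
  have hb0 : 0 ≤ armRate y ^ 2 := by positivity
  have h1 : armRate y ^ 2 ≤ y + D / (2 * y) := by
    by_contra h
    push Not at h
    have h2 : (y + D / (2 * y)) ^ 2 < (armRate y ^ 2) ^ 2 := pow_lt_pow_left₀ h (by positivity) (by norm_num)
    have e : (y + D / (2 * y)) ^ 2 = y ^ 2 + D + (D / (2 * y)) ^ 2 := by field_simp; ring
    have : (armRate y ^ 2) ^ 2 = armRate y ^ 4 := by ring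
    rw [this, e] at h2
    have : y ^ 2 + D = y ^ 2 + 2 + 2 / y + 423188 / (y * Real.sqrt y) := by rw [hD]; ring
    nlinarith [sq_nonneg (D / (2 * y))]
  have e2 : D / (2 * y) = 1 / y + 1 / y ^ 2 + 211594 / (y ^ 2 * Real.sqrt y) := by
    rw [hD]; field_simp; ring
  have h3 : 211594 / (y ^ 2 * Real.sqrt y) ≤ 211595 / (y ^ 2 * Real.sqrt y) :=
    div_le_div_of_nonneg_right (by norm_num) (by positivity)
  linarith

/-- ★★★ **`y²(β_rot(y)² − y − 1/y) ≤ 1 + 211595/√y`** (`y ≥ 10⁴`): `limsup_{y→∞} y²(β_rot² − y − 1/y) ≤ 1`.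
[cite: Beaton2014RotatedHoneycomb, §3.1 (arXiv v3 p. 12)] -/
theorem sq_mul_armRate_sq_sub_sub_le (hy : 10000 ≤ y) : y ^ 2 * (armRate y ^ 2 - y - 1 / y) ≤ 1 + 211595 / Real.sqrt y := by
  have hy0 : 0 < y := by linarith
  have h := armRate_sq_le_third hy
  have h1 : y ^ 2 * (armRate y ^ 2 - y - 1 / y) ≤ y ^ 2 * (1 / y ^ 2 + 211595 / (y ^ 2 * Real.sqrt y)) :=
    mul_le_mul_of_nonneg_left (by linarith) (by positivity)
  have e : y ^ 2 * (1 / y ^ 2 + 211595 / (y ^ 2 * Real.sqrt y)) = 1 + 211595 / Real.sqrt y := by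
    field_simp
  linarith

/-- ★★★ **`limsup_{y→∞} y²(β_rot(y)² − y − 1/y) ≤ 1`**: for every `ε > 0`, eventually `y²(β_rot² − y − 1/y) ≤ 1 + ε`.
[cite: Beaton2014RotatedHoneycomb, §3.1 (arXiv v3 p. 12)] -/
theorem eventually_sq_mul_armRate_sq_sub_sub_le {ε : ℝ} (hε : 0 < ε) :
    ∀ᶠ y : ℝ in atTop, y ^ 2 * (armRate y ^ 2 - y - 1 / y) ≤ 1 + ε := by
  have h1 : Tendsto (fun y : ℝ => (211595 : ℝ) / Real.sqrt y) atTop (𝓝 0) :=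
    tendsto_const_nhds.div_atTop (Real.tendsto_sqrt_atTop)
  filter_upwards [eventually_ge_atTop (10000 : ℝ), (tendsto_order.1 h1).2 ε hε] with y hy hlt
  linarith [sq_mul_armRate_sq_sub_sub_le hy]

end Literature.Probability.RandomPlanarGeometry.SAW.HexBW.Arm

/-! ### §8  Transfer to Beaton's `μ_rot = HV.rotSurfaceMu` -/

namespace Literature.Probability.RandomPlanarGeometry.SAW.HV

open Literature.Probability.RandomPlanarGeometry.SAW.HexBW.Arm

variable {y : ℝ}

/-- ★★★ **`μ_rot(y)² ≤ y + 1/y + 1/y² + 211595/(y²√y)`** (`y ≥ 10⁴`). [cite: Beaton2014RotatedHoneycomb, Proposition 7 (arXiv v3 p. 11), §3.1 (p. 12)] -/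
theorem rotSurfaceMu_sq_le_third (hy : 10000 ≤ y) :
    rotSurfaceMu y ^ 2 ≤ y + 1 / y + 1 / y ^ 2 + 211595 / (y ^ 2 * Real.sqrt y) := by
  rw [rotSurfaceMu_eq_armRate_of_four_le (by linarith)]; exact armRate_sq_le_third hy

/-- ★★★ Eventually `y²(μ_rot(y)² − y − 1/y) ≤ 1 + ε`. [cite: Beaton2014RotatedHoneycomb, Proposition 7 (arXiv v3 p. 11), §3.1 (p. 12)] -/
theorem eventually_sq_mul_rotSurfaceMu_sq_sub_sub_le {ε : ℝ} (hε : 0 < ε) :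
    ∀ᶠ y : ℝ in atTop, y ^ 2 * (rotSurfaceMu y ^ 2 - y - 1 / y) ≤ 1 + ε := by
  filter_upwards [eventually_sq_mul_armRate_sq_sub_sub_le hε, eventually_ge_atTop (4 : ℝ)] with y h hy
  rwa [rotSurfaceMu_eq_armRate_of_four_le hy]

end Literature.Probability.RandomPlanarGeometry.SAW.HV
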